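/-
Copyright: statement-level skeleton of a published paper (lit-balaban cell, Phase-2 proof seat p39 gen 24). No proof claims
beyond what the kernel checks below.
-/
import Mathlib.Topology.Instances.Matrix
import Literature.MathematicalPhysics.QuantumFieldTheory.Balaban1983to89.B3Eq121DysonSeries
import Literature.MathematicalPhysics.QuantumFieldTheory.Balaban1983to89.B3Eq122ChargeWick

/-!
# Bałaban, *(Higgs)₂,₃ quantum fields in a finite volume. III*, CMP 88 (1983) [Balaban1983Higgs3], p. 416: THE TERM
# ⑦ `e²Σ_μΣ_{x″}ε^d q(∂^ε_μC^ε_0)(x−x″)δm²(C^ε_0∂^{ε*}_μ)(x″−x′)qC^ε(x−x′)` OF (1.22) — THE ORDER `e²δm²` OF THE TWO-POINT FUNCTION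
# (1.19)/(1.20) — DERIVED BY THE MASS-INSERTION IDENTITY `∂_{m²}C^η_{m²} = −C₀⋆C₀` FROM THE DERIVED ORDER-`e²` STRUCTURE
# (BRICK 7 `B3Eq122ChargeWick`); and the exact pure-counterterm sector of (1.21)

statement-level skeleton of published theorems with citation tags; proofs where landed; nothing here is a claim about the
Yang–Mills mass gap.

[cite: Balaban1983Higgs3, (1.19)–(1.22) p.416 (PDF 6); (1.7) p.413 (PDF 3)].  Unit `lit-balaban-p39-g24` (Phase-2 proof seat p39,
gen 24), free-target protocol G.5-34(d), zero head weight: BRICK 8 of the optional target named in r15 g15's HEAD QUESTION 25 —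
row **B3.Eq1.19-1.22** of `HOME/lit-balaban-r15/ROWS-B3.md` (owner r15, head `proved` on the owner path, reading (P) of the
lead g12's Q25/Q28′ words), (1.22) cell, OPTIONAL LOCATED MEMBER; the successor brick this seat's gen 23 named («⑦ (e²δm²): δm² as
a second variable»); TAKING HOME/STATUS 2026-08-23T16:22:46Z (20-min window, no objection).  Sibling bricks (disjoint, nothing
of theirs re-derived): BRICK 1 `B3Eq122FirstOrderWick` (this seat: ①, ⑥ at `e = 0`), BRICK 7 `B3Eq122ChargeWick` (this seat: ②,
④ at order `e²` — IMPORTED: its carrier, its Wick theorems and its derived structure are the input here), BRICKS 2–6 and the K/F/G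
files of p32/p33/p37 (chains, 1PI predicates, all-orders coefficients, the `e > 0` sector on the `HiggsLattice` carrier — none
imported), p26's `B3Eq123Counterterms` (the seven displayed terms `sig1 … sig7` of (1.22) AS PRINTED — ⑦ = `sig7`, consumed by name).

PDF held: `paper:balaban1983-higgs-2-3-quantum-fields-finite-volume` (journal page = PDF page + 410); p. 416 re-read for this file
on the ×2 render `run/shared/lean/pub/pub-balaban/b2b-balaban-ref1/pages/1983-cmp88-higgs23-III/1983-cmp88-higgs23-III-p006-x2.png`
(2026-08-23T17:30Z): the display (1.20), the series (1.21), the last written term of (1.22) and its picture (the graph ④ with a dot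
`δm²` on the scalar line between `x` and `x′`), and the sentence on the vertices.

THE PRINTED TEXT (verbatim, p. 416).  *"S^ε(A,φ) = ½⟨φ,(−Δ^ε_A + m²)φ⟩ + Σ_{x∈T_ε}ε^d(λ∣φ(x)∣⁴ + ½δm²∣φ(x)∣²) + ½⟨A,(−Δ^ε + μ₀²)A⟩,
(1.20) … The function G^ε has a perturbative expansion of the following structure G^ε = Σ_{n=0}^∞ C₀^ε[(−δm² + Σ^ε + ∂^{ε*}Σ₁^ε +
Σ₁^{ε*}∂^ε + ∂^{ε*}Σ₂^ε∂^ε)C₀^ε]ⁿ, (1.21) where C₀^ε = (−Δ₀^ε + m²)^{−1} and Σ^ε, Σ₁^ε, Σ₂^ε are given by amputated,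
one-particle-irreducible graphs of the expansion of G^ε. … the only vertices are (1.6), (1.7) [with δm² instead of δm²_l(x)], (1.8),
and (1.10) … Let us write a few terms of the expansion of Σ^ε: Σ^ε(x−x′) = −4(N+2)λC^ε_0(0)δ^ε(x−x′) + e²dC^ε(0)q²δ^ε(x−x′) + … −
e²Σ_{μ=1}^d q(∂^ε_μC^ε_0∂^{ε*}_μ)(x−x′)qC^ε(x−x′) + … + e²Σ_{μ=1}^dΣ_{x″∈T_ε}ε^dq(∂^ε_μC^ε_0)(x−x″)δm²(C^ε_0∂^{ε*}_μ)(x″−x′)qC^ε(x−x′)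
+ … (1.22) Here we did not write, and we will not write in the future, combinatoric factors before the graphs"* — the last written
term is ⑦ in p26's numbering (`B3Eq123Counterterms.sig7`); ② and ④ are the two terms of order exactly `e²λ⁰(δm²)⁰` (BRICK 7).

THE OBSERVATION THIS FILE FORMALIZES.  In (1.20) the counterterm is a MASS SHIFT: `½⟨φ,m²φ⟩ + Σ_xε^d·½δm²∣φ(x)∣² =
½(m²+δm²)Σ_xε^d∣φ(x)∣²` (r15's typed Feynman-gauge action `LatticeFieldCalculus.feynmanHiggsAction` carries the one letter `m₀²`,
the typer's `B3Sect1TwoPoint.action120` sets `m₀² = m² + δm²`), so the two-point function (1.19) with counterterm `δm²` (`λ = 0`) is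
BRICK 7's `twoPt` at scalar mass `m² + δm²` (`J_mass_shift_eq_exp_neg_feynmanHiggsAction`), and ITS `δm²`-DEPENDENCE IS ITS
`m²`-DEPENDENCE.  The vertex (1.7) of the expansion — Feynman rule `−δm²`, the letter `−δm²` of `X` in (1.21) — is generated by
differentiating free scalar lines in their mass: **`∂_{m²}C^η_{m²}(x,y) = −Σ_zη^dC^η_{m²}(x,z)C^η_{m²}(z,y)`** (`hasDerivAt_G_apply`, the
resolvent identity for this seat's concrete propagator `B3WTPropagator.G = (η^d(−Δ^η+m²))⁻¹`).  Applied to BRICK 7's DERIVED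
order-`e²` structure `T := (e²/2)∂²_e∣₀G_{ab} = C₀[② + ④ + Σ_μ(∂^{ε*}_μΣ₁,μ + Σ₁,μ^*∂^ε_μ + ∂^{ε*}_μΣ₂∂^ε_μ)]C₀`
(`B3Eq122ChargeWick.secondOrder_eq_structure121`, valid at every scalar mass — `secondOrder_eq_E2`), the product rule puts the
mass vertex either on one of the two external legs — giving `−(C₀⋆T + T⋆C₀)`, the two `n = 2` cross terms
`C₀(−δm²)C₀·X₂·C₀ + C₀·X₂·C₀(−δm²)C₀` of (1.21) per unit `δm²` — or on the internal scalar line of ④, of `Σ₁,μ`, of `Σ₂` (② and the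
local part of `Σ₁,μ` have none) — giving the `n = 1` term at order `e²δm²`, whose `Σ^ε`-part is EXACTLY THE PRINTED ⑦.

THE SETTING is BRICK 7's (its module docstring): scalar fields `φ : T → ℝ^N` on the model torus `T^{(j)}_η`, the vector field in
components, the Feynman gauge, the charge `e` a variable, `twoPt C η w c m2 μ2 e a b x x'` = (1.19) at `λ = 0` and scalar mass `m2`;
`C₀ = C^η_{m²} = G w c m2`, `C^ε = G w c μ2`; `w = η^d`, `c = η⁻¹` (`cη = 1`); hypotheses `η^d > 0`, `m² > 0`, `μ₀² > 0`; any `d`, `N`,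
`j`.  `(C₀⋆C₀)(u,v) := Σ_zη^dC₀(u,z)C₀(z,v)` (`Gins`) is the scalar line with one mass insertion per unit `−δm²`.

WHAT THIS FILE PROVES (theorems; definitions = the explicit kernels listed; no definition of record redeclared; no named fact;
no `sorry`; standard axioms).
* §1 **RESOLVENT CALCULUS FOR `C^η_{M²}`**: `Ks_eq_add_smul` (`η^d(−Δ^η+M²) = η^d(−Δ^η) + M²η^d·1`), **`G_sub_G`** (`C_M − C_{M′} =
  (M′²−M²)η^d·C_MC_{M′}`, Mathlib's `Matrix.inv_sub_inv`), `continuousAt_G` (`continuousAt_matrix_inv`), **`hasDerivAt_G_apply`**: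
  `∂_{M²}C^η_{M²}(x,y) = −Σ_zη^dC_M(x,z)C_M(z,y)` (slope = `−Σ_zη^dC_{M′}(x,z)C_M(z,y)` off the diagonal, continuous at `M′ = M`).
* §2 the insertion kernel `Gins` and the mass derivatives of r15's difference-quotient kernels `d1Kernel`/`dAdjKernel`/`dKernel` of
  `C₀` (linear in the kernel); **`dKernel_Gins`**: `(∂_μ(C₀⋆C₀)∂^*_μ)(y,y′) = Σ_{x″}η^d(∂^ε_μC₀)(y,x″)(C₀∂^{ε*}_μ)(x″,y′)` — the two halves
  of ⑦; the generic Leibniz rule for a «sandwich» `Σ_{y,y′}η^{2d}ℓ(y)ι(y,y′)r(y′)` (`hasDerivAt_sandwich`) and the two chain lemmas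
  (`chain_left`/`chain_right`: an insertion on a leg = a free propagator prepended or appended to the whole sandwich).
* §3 **THE SECTOR `e⁰`**: `twoPt_zero_mass` (`G_{0,ab}(x,x′; m²+δm²) = C^η_{m²+δm²}(x′,x)δ_{ab}`, all orders in `δm²` at once, BRICK 7
  `twoPt_zero`), **`hasDerivAt_twoPt_zero_mass`** (`∂_{δm²}∣₀ = −(C₀⋆C₀)δ_{ab}`: the `n = 1` term `C₀(−δm²)C₀` per unit `δm²`),
  **`eq121_counterterm`**: r15's resummed (1.21) `B3Sect1TwoPoint.Eq121 G C₀ X` HOLDS EXACTLY with `G = η^d·C^η_{m²+δm²}`,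
  `C₀ = η^d·C^η_{m²}`, `X = −δm²·1` in the matrix ring (`K ↦ η^d·K` turns the `η^d`-weighted composition of kernels into the matrix
  product) for every `δm² > −m²` — the first sector in which (1.21) is a THEOREM ABOUT (1.19) rather than a typed structure
  (non-perturbative; its iteration is the printed `Σ_nC₀[(−δm²)C₀]ⁿ`, r15's `dyson_partial`; p32's `B3Eq121DysonSeries` has the
  normed-ring summation); `G_mass_shift_eq` (the same as kernels); `deriv_twoPt_zero_mass` (order `e¹δm²ᵏ` vanishes, §5).
* §4 **THE SECTOR `e²δm²`** (explicit level): the insertions at scalar mass `M²` — `ins24` (② + ④, p26's `sig2 + sig4` with `C₀ :=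
  C^η_{M²}`), BRICK 7's derived `sgOne`/`sgTwo` — and their mass derivatives **`ins7`** (`= sig7 D 1`, §5), **`sgOneIns`**
  (`Σ⁽⁷⁾₁,μ = −e²q²((C₀⋆C₀)∂^{ε*}_μ)(y,y′)C^ε(y,y′)`: the mass vertex on the internal scalar line of `Σ₁,μ`; its local tadpole part has
  none), **`sgTwoIns`** (`Σ⁽⁷⁾₂ = e²q²(C₀⋆C₀)(y,y′)C^ε(y,y′)`) (`hasDerivAt_ins24`, `hasDerivAt_sgOne`, `hasDerivAt_sgTwo`); the four
  sandwiches `S0` (`C₀[②+④]C₀`), `S1`/`S2`/`S3` (`C₀∂^*_μΣ₁,μC₀`, `C₀Σ₁,μ^*∂_μC₀`, `C₀∂^*_μΣ₂∂_μC₀`) and their sum **`E2`** as explicit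
  functions of `M²`, the insertion counterparts `S0ins…S3ins`/**`Ins7`**; family by family `hasDerivAt_S0…S3` (Leibniz, then the
  leg insertions become chains by the symmetry of `C₀` and `d1Kernel_Gins`), and **`hasDerivAt_E2`**:
  `∂_{M²}∣_{m²}E2(x,x′) = −Σ_zη^dC₀(x,z)E2(z,x′) + Ins7(x,x′) − Σ_zη^dE2(x,z)C₀(z,x′)`.
* §5 **THE MAIN THEOREMS.** `secondOrder_eq_E2`: BRICK 7's structure theorem instantiated at every scalar mass `M² > 0` IS `E2(M²)`;
  **`ins7_eq_sig7`**/`dm2_mul_ins7_eq_sig7`: `δm²·∂_{m²}(②+④) = sig7 D δm²` — THE PRINTED ⑦, its sign `+e²` and the absence of any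
  further combinatoric factor being what the mass-insertion identity gives from ④; `Ins7_eq_sig7`;
  **`hasDerivAt_secondOrder_mass`** / **`hasDerivAt_counterterm_secondOrder`**: for p26's data `D` of (1.22) (`D.e = e`, `D.q2 =
  (q²)_{ab}`, `D.C0 = C₀`, `D.C = C^ε`, `D.w = η^d`, `D.c = η⁻¹`),
  **`d/dδm²∣₀[(e²/2)∂²_e∣₀G_{ab}(x,x′; m²+δm²)] = −Σ_zη^dC₀(x,z)T(z,x′) + Ins7(x,x′) − Σ_zη^dT(x,z)C₀(z,x′)`**,
  `Ins7 = C₀·(sig7 D 1)·C₀ + Σ_μ(C₀∂^{ε*}_μΣ⁽⁷⁾₁,μC₀ + C₀Σ⁽⁷⁾₁,μ^*∂^ε_μC₀ + C₀∂^{ε*}_μΣ⁽⁷⁾₂∂^ε_μC₀)` as kernels.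
* §6 **AS OPERATORS** (r15's `kernelOp η^d`, `pdiff`/`pdiffAdj` = `∂^η_μ`/`∂^{η*}_μ`, BRICK 7's `sum_G_mul_pdiffAdj`): `kernelOp_Ins7`
  (`Ins7` acts as `C₀[⑦₁ + Σ_μ(∂^{η*}_μΣ⁽⁷⁾₁,μ + Σ⁽⁷⁾₁,μ^*∂^η_μ + ∂^{η*}_μΣ⁽⁷⁾₂∂^η_μ)]C₀`) and **`secondOrderMass_structure121_op`**: with
  `𝒯 = kernelOp η^d T` (`= C₀X₂C₀`, BRICK 7 `secondOrder_structure121_op`), the operator of `δm²·∂_{m₀²}∣_{m²}T` is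
  `C₀(−δm²·𝒯f) + C₀[δm²·(⑦₁ + …)](C₀f) + 𝒯(−δm²·C₀f)` — **the two `n = 2` cross terms `C₀(−δm²)C₀X₂C₀ + C₀X₂C₀(−δm²)C₀ and the
  `n = 1` term `C₀X⁽⁷⁾C₀` of (1.21) at order `e²δm²`, DERIVED from (1.19)/(1.20)** (r15's row disclosure «(1.21) typed as the printed
  Dyson structure for SUPPLIED self-energies — NOT derived from (1.19)» has, after BRICKS 1/7, one more derived order).
v1.1 (same seat and gen, APPEND-ONLY after v1.0's last declaration `secondOrderMass_structure121_op`, §7; one import added,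
`B3Eq121DysonSeries`): **THE PRINTED SERIES (1.21) CONVERGES TO THE TWO-POINT FUNCTION IN THE SECTOR `e = λ = 0`** —
`smul_G_mass_shift_eq_tsum_dysonTerm`: for `∣δm²∣·‖η^dC^η_{m²}‖ < 1` (operator norm on `ℓ^∞(T)`, Mathlib's `Matrix.linftyOp*` structures
as local instances) `η^d·C^η_{m²+δm²} = Σ'_n (η^dC₀)[(−δm²·1)(η^dC₀)]ⁿ` (r15's `dysonTerm`; p32's `B3Eq121DysonSeries.eq_tsum_of_eq121`
= uniqueness for `Eq121` in a complete normed ring, applied to `eq121_counterterm`), entrywise `G_mass_shift_eq_tsum_dysonTerm_apply`;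
with `twoPt_zero_mass`: `G_{0,ab}(x,x′; m²+δm²) = δ_{ab}·η^{−d}(Σ_{n=0}^∞C₀[(−δm²)C₀]ⁿ)(x′,x)` — (1.21) with `X = −δm²` as a convergent series equal
to (1.19), not only its resummed form.
HONEST SCOPE.  (i) `δm²` enters only through `m₀² = m² + δm²` (as in (1.20) and in the tree's typed action), so every
`δm²`-derivative here is an `m²`-derivative of BRICK 7's objects; (ii) orders `e⁰δm²ᵏ` (all `k`, exact) and `e²δm²` only — NOT
`e²(δm²)²`, NOT ③/⑤ (`e⁴`), NOT the mixed `e²λ` graphs, `λ = 0` throughout; (iii) the mixed third derivative is the ITERATED one,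
`∂²_e` at `e = 0` first (BRICK 7's `iteratedDeriv 2`), then `∂_{m₀²}` at `m²` — no joint-smoothness or Schwarz statement is made or
needed; (iv) Feynman gauge as the definition of the `A`-integral, `cη = 1`, finite torus, `m², μ₀² > 0` — as in BRICK 7; (v) `Σ⁽⁷⁾₁,μ`,
`Σ⁽⁷⁾₂` are what the Feynman rules give at this order (the paper displays no `Σ₁^ε`, `Σ₂^ε` kernel); no one-particle-irreducibility or
all-orders claim, no `ε → 0` statement, no size estimate.  Mathlib: `Matrix.inv_sub_inv`, `continuousAt_matrix_inv`,
`NormedRing.inverse_continuousAt`, `hasDerivAt_iff_tendsto_slope`, `HasDerivAt.congr_of_eventuallyEq`.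
-/

noncomputable section

open scoped BigOperators InnerProductSpace Topology

namespace Literature.MathematicalPhysics.QuantumFieldTheory.Balaban1983to89.B3Eq122MassInsertionWick

open _root_.MeasureTheory _root_.Filter
open LatticeFieldCalculus B3WT223Instance B3WTPropagator B3Eq123Counterterms B3Sect3ScalarSelfEnergy
  B3Sect3VectorSelfEnergy B3Eq122ChargeWick

variable {P : Params} {j N : ℕ} (C : HiggsLattice.ChargeData N) (η w c m2 : ℝ)

/-! ## §1 The mass-insertion identity for `C^η_{M²} = (−Δ^η+M²)⁻¹`: resolvent identity, continuity, `∂_{M²}C = −C⋆C` -/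

omit C η m2 in
/-- the scalar form is affine in the mass: `⟨a,(−Δ^η+M²)a′⟩ = ⟨a,(−Δ^η)a′⟩ + M²Σ_xη^d a(x)a′(x)`. [cite: Balaban1983Higgs3, (2.25) p.431] -/
theorem sform_eq_sform_zero_add (M : ℝ) (a a' : Site P j → ℝ) :
    sform w c M a a' = sform w c 0 a a' + M * ∑ x : Site P j, w * (a x * a' x) := by
  simp only [sform, zero_mul, add_zero]

omit C η m2 in
/-- the matrix `K_{M²} = η^d(−Δ^η+M²)` is affine in the mass: `K_{M²} = K_0 + M²η^d·1`. [cite: Balaban1983Higgs3, (2.25) p.431] -/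
theorem Ks_eq_add_smul (M : ℝ) : Ks w c M = Ks w c 0 + (M * w) • (1 : Matrix (Site P j) (Site P j) ℝ) := by
  ext x y
  rw [Matrix.add_apply, Matrix.smul_apply, Ks_apply, Ks_apply, sform_eq_sform_zero_add, Matrix.one_apply, smul_eq_mul]
  congr 1
  by_cases hxy : x = y
  · subst hxy
    rw [if_pos rfl, Finset.sum_eq_single x (fun z _ hz => by simp [Ne.symm hz])
      (fun h => absurd (Finset.mem_univ x) h)]
    simp
  · rw [if_neg hxy, mul_zero]
    refine (mul_eq_zero.mpr (Or.inr (Finset.sum_eq_zero fun z _ => ?_)))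
    by_cases hz : z = x
    · subst hz; simp [Ne.symm hxy]
    · simp [Pi.single_apply, hz]

omit C η m2 in
/-- `K_{M²}` is invertible for `η^d > 0`, `M² > 0`. [cite: Balaban1983Higgs3, (2.26) p.431] -/
theorem isUnit_Ks (hw : 0 < w) {M : ℝ} (hM : 0 < M) : IsUnit (Ks w c M : Matrix (Site P j) (Site P j) ℝ) :=
  (Ks_posDef w c M hw hM).isUnit

omit C η m2 in
/-- **THE RESOLVENT IDENTITY** `C^η_{M²} − C^η_{M′²} = (M′²−M²)·Σ_zη^dC^η_{M²}(·,z)C^η_{M′²}(z,·)`, i.e. as matrices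
`G(M) − G(M′) = ((M′−M)η^d)·G(M)G(M′)` (`K_{M′} − K_M = (M′−M)η^d·1`). [cite: Balaban1983Higgs3, (1.21) p.416] -/
theorem G_sub_G (hw : 0 < w) {M M' : ℝ} (hM : 0 < M) (hM' : 0 < M') :
    G w c M - G w c M' = ((M' - M) * w) • (G w c M * G w c M' : Matrix (Site P j) (Site P j) ℝ) := by
  have h := Matrix.inv_sub_inv (A := (Ks w c M : Matrix (Site P j) (Site P j) ℝ)) (B := Ks w c M')
    ⟨fun _ => isUnit_Ks (P := P) (j := j) w c hw hM', fun _ => isUnit_Ks (P := P) (j := j) w c hw hM⟩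
  have hKK : Ks w c M' - Ks w c M = ((M' - M) * w) • (1 : Matrix (Site P j) (Site P j) ℝ) := by
    rw [Ks_eq_add_smul w c M', Ks_eq_add_smul w c M, add_sub_add_left_eq_sub, ← sub_smul, ← sub_mul]
  rw [G, G, h, hKK, Matrix.mul_smul, Matrix.mul_one, Matrix.smul_mul]

omit C η m2 in
/-- the resolvent identity entrywise: `C_M(x,y) − C_{M′}(x,y) = (M′−M)Σ_zη^dC_M(x,z)C_{M′}(z,y)`. [cite: Balaban1983Higgs3, (1.21) p.416] -/
theorem G_sub_G_apply (hw : 0 < w) {M M' : ℝ} (hM : 0 < M) (hM' : 0 < M') (x y : Site P j) :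
    G w c M x y - G w c M' x y = (M' - M) * ∑ z : Site P j, w * (G w c M x z * G w c M' z y) := by
  have h := congrFun (congrFun (G_sub_G w c hw hM hM') x) y
  rw [Matrix.sub_apply, Matrix.smul_apply, smul_eq_mul, Matrix.mul_apply] at h
  rw [h, mul_assoc, Finset.mul_sum]

omit C η m2 in
/-- `M² ↦ K_{M²}` is continuous (affine). [cite: Balaban1983Higgs3, (2.25) p.431] -/
theorem continuous_Ks : Continuous fun M : ℝ => (Ks w c M : Matrix (Site P j) (Site P j) ℝ) := by
  have h : (fun M : ℝ => (Ks w c M : Matrix (Site P j) (Site P j) ℝ)) =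
      fun M => Ks w c 0 + (M * w) • (1 : Matrix (Site P j) (Site P j) ℝ) := funext fun M => Ks_eq_add_smul w c M
  rw [h]
  exact continuous_const.add ((continuous_id.mul continuous_const).smul continuous_const)

omit C η m2 in
/-- **`M² ↦ C^η_{M²}` is continuous** at every `M² > 0` (`η^d > 0`). [cite: Balaban1983Higgs3, (1.21) p.416] -/
theorem continuousAt_G (hw : 0 < w) {M : ℝ} (hM : 0 < M) :
    ContinuousAt (fun M' : ℝ => (G w c M' : Matrix (Site P j) (Site P j) ℝ)) M := by
  have hdet : (Ks w c M : Matrix (Site P j) (Site P j) ℝ).det ≠ 0 := (Ks_posDef w c M hw hM).det_pos.ne'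
  have hinv : ContinuousAt Ring.inverse (Ks w c M : Matrix (Site P j) (Site P j) ℝ).det := by
    have := NormedRing.inverse_continuousAt (Units.mk0 _ hdet)
    rwa [Units.val_mk0] at this
  exact (continuousAt_matrix_inv _ hinv).comp (continuous_Ks w c).continuousAt

omit C η m2 in
/-- continuity of the entries `M² ↦ C^η_{M²}(x,y)`. [cite: Balaban1983Higgs3, (1.21) p.416] -/
theorem continuousAt_G_apply (hw : 0 < w) {M : ℝ} (hM : 0 < M) (x y : Site P j) :
    ContinuousAt (fun M' : ℝ => G w c M' x y) M := by
  have h := continuousAt_G (P := P) (j := j) w c hw hM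
  rw [ContinuousAt] at h ⊢
  exact (tendsto_pi_nhds.1 (tendsto_pi_nhds.1 h x)) y

omit C η m2 in
/-- **THE MASS-INSERTION IDENTITY `∂_{M²}C^η_{M²}(x,y) = −Σ_zη^dC^η_{M²}(x,z)C^η_{M²}(z,y)`** — differentiating the free propagator
in its mass inserts the vertex (1.7) (`−½δm²∣φ∣²` per unit `δm²`, kernel `−δ^ε`) on the line: the `n = 1` term `C₀(−δm²)C₀` of
(1.21) per unit `δm²`. [cite: Balaban1983Higgs3, (1.21) p.416] -/
theorem hasDerivAt_G_apply (hw : 0 < w) {M : ℝ} (hM : 0 < M) (x y : Site P j) :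
    HasDerivAt (fun M' : ℝ => G w c M' x y) (-∑ z : Site P j, w * (G w c M x z * G w c M z y)) M := by
  rw [hasDerivAt_iff_tendsto_slope]
  -- off the diagonal the slope IS `−Σ_z η^d C_{M′}(x,z)C_M(z,y)` (resolvent identity), which is continuous at `M′ = M`
  have hF : Tendsto (fun M' : ℝ => -∑ z : Site P j, w * (G w c M' x z * G w c M z y)) (𝓝 M)
      (𝓝 (-∑ z : Site P j, w * (G w c M x z * G w c M z y))) :=
    (tendsto_finsetSum _ fun z _ =>
      (((continuousAt_G_apply w c hw hM x z).tendsto.mul tendsto_const_nhds).const_mul w)).neg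
  refine (hF.mono_left nhdsWithin_le_nhds).congr' ?_
  have hpos : ∀ᶠ M' in 𝓝[≠] M, 0 < M' :=
    mem_nhdsWithin_of_mem_nhds (Ioi_mem_nhds hM)
  filter_upwards [hpos, self_mem_nhdsWithin] with M' hM' hne
  rw [slope_def_field, G_sub_G_apply w c hw hM' hM x y]
  have hne' : M' - M ≠ 0 := sub_ne_zero.mpr hne
  field_simp
  ring


/-! ## §2 The propagator with one mass insertion `(C₀⋆C₀)(u,v) = Σ_zη^dC₀(u,z)C₀(z,v)` and the derivatives of the kernel maps -/

omit C η m2 in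
/-- **`C₀⋆C₀`**: the free scalar line with ONE mass-renormalization vertex (1.7) inserted (per unit `−δm²`):
`(C₀⋆C₀)(u,v) = Σ_{z∈T}η^dC^η_{M²}(u,z)C^η_{M²}(z,v)` — the kernel of `C₀·1·C₀` in the `η^d`-weighted convention, so that the
`n = 1` term of (1.21) with `X = −δm²` reads `−δm²·(C₀⋆C₀)`. [cite: Balaban1983Higgs3, (1.21) p.416] -/
def Gins (M : ℝ) : Kernel P j := fun u v => ∑ z : Site P j, w * (G w c M u z * G w c M z v)

omit C η m2 in
/-- `C₀⋆C₀` is symmetric. [cite: Balaban1983Higgs3, (1.21) p.416] -/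
theorem Gins_symm (M : ℝ) (u v : Site P j) : Gins w c M u v = Gins w c M v u := by
  simp only [Gins]
  exact Finset.sum_congr rfl fun z _ => by rw [G_symm w c M u z, G_symm w c M z v]; ring

omit C η m2 in
/-- the mass-insertion identity in the `Gins` notation: `∂_{M²}C₀(x,y) = −(C₀⋆C₀)(x,y)`. [cite: Balaban1983Higgs3, (1.21) p.416] -/
theorem hasDerivAt_G_apply' (hw : 0 < w) {M : ℝ} (hM : 0 < M) (x y : Site P j) :
    HasDerivAt (fun M' : ℝ => G w c M' x y) (-Gins w c M x y) M :=
  hasDerivAt_G_apply w c hw hM x y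

omit C η m2 in
/-- `∂^η_μ` on the left variable commutes with the insertion: `(∂_μ(C₀⋆C₀))(y,x) = Σ_zη^d(∂_μC₀)(y,z)C₀(z,x)`.
[cite: Balaban1983Higgs3, (1.21) p.416] -/
theorem d1Kernel_Gins (M : ℝ) (μ : Fin P.d) (y x : Site P j) :
    d1Kernel c μ (Gins w c M) y x = ∑ z : Site P j, w * (d1Kernel c μ (G w c M) y z * G w c M z x) := by
  simp only [d1Kernel, Gins, Finset.mul_sum, ← Finset.sum_sub_distrib]
  exact Finset.sum_congr rfl fun z _ => by ring

omit C η m2 in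
/-- the same with the undifferentiated factor written on the left (symmetry of `C₀`):
`(∂_μ(C₀⋆C₀))(y,x) = Σ_zη^dC₀(x,z)(∂_μC₀)(y,z)`. [cite: Balaban1983Higgs3, (1.21) p.416] -/
theorem d1Kernel_Gins' (M : ℝ) (μ : Fin P.d) (y x : Site P j) :
    d1Kernel c μ (Gins w c M) y x = ∑ z : Site P j, w * (G w c M x z * d1Kernel c μ (G w c M) y z) := by
  rw [d1Kernel_Gins]
  exact Finset.sum_congr rfl fun z _ => by rw [G_symm w c M z x]; ring

omit C η m2 in
/-- `∂^{η*}_μ` on the right variable commutes with the insertion: `((C₀⋆C₀)∂^*_μ)(y,y′) = Σ_zη^dC₀(y,z)(C₀∂^*_μ)(z,y′)`.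
[cite: Balaban1983Higgs3, (1.21) p.416] -/
theorem dAdjKernel_Gins (M : ℝ) (μ : Fin P.d) (y y' : Site P j) :
    dAdjKernel c μ (Gins w c M) y y' = ∑ z : Site P j, w * (G w c M y z * dAdjKernel c μ (G w c M) z y') := by
  simp only [dAdjKernel, Gins, Finset.mul_sum, ← Finset.sum_sub_distrib]
  exact Finset.sum_congr rfl fun z _ => by ring

omit C η m2 in
/-- **the doubly differentiated line with a mass insertion factorizes through the vertex**:
`(∂_μ(C₀⋆C₀)∂^*_μ)(y,y′) = Σ_{x″}η^d(∂^ε_μC₀)(y,x″)(C₀∂^{ε*}_μ)(x″,y′)` — the two halves `q(∂^ε_μC^ε_0)(x−x″)` and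
`(C^ε_0∂^{ε*}_μ)(x″−x′)q` of the print's ⑦. [cite: Balaban1983Higgs3, (1.22) term ⑦ p.416] -/
theorem dKernel_Gins (M : ℝ) (μ : Fin P.d) (y y' : Site P j) :
    dKernel c μ (Gins w c M) y y' =
      ∑ z : Site P j, w * (d1Kernel c μ (G w c M) y z * dAdjKernel c μ (G w c M) z y') := by
  simp only [dKernel, d1Kernel, dAdjKernel, Gins, Finset.mul_sum, ← Finset.sum_sub_distrib, ← Finset.sum_add_distrib]
  exact Finset.sum_congr rfl fun z _ => by ring

omit C η m2 in
/-- `∂_{M²}(∂_μC₀)(y,x) = −(∂_μ(C₀⋆C₀))(y,x)` (the difference quotient is linear in the kernel). [cite: Balaban1983Higgs3, (1.21) p.416] -/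
theorem hasDerivAt_d1Kernel_G (hw : 0 < w) {M : ℝ} (hM : 0 < M) (μ : Fin P.d) (y x : Site P j) :
    HasDerivAt (fun M' : ℝ => d1Kernel c μ (G w c M') y x) (-d1Kernel c μ (Gins w c M) y x) M := by
  have h : HasDerivAt (fun M' : ℝ => d1Kernel c μ (G w c M') y x)
      (c * (-Gins w c M (y.shift μ) x - -Gins w c M y x)) M :=
    ((hasDerivAt_G_apply' w c hw hM (y.shift μ) x).sub (hasDerivAt_G_apply' w c hw hM y x)).const_mul c
  refine h.congr_deriv ?_
  simp only [d1Kernel]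
  ring

omit C η m2 in
/-- `∂_{M²}(C₀∂^*_μ)(y,y′) = −((C₀⋆C₀)∂^*_μ)(y,y′)`. [cite: Balaban1983Higgs3, (1.21) p.416] -/
theorem hasDerivAt_dAdjKernel_G (hw : 0 < w) {M : ℝ} (hM : 0 < M) (μ : Fin P.d) (y y' : Site P j) :
    HasDerivAt (fun M' : ℝ => dAdjKernel c μ (G w c M') y y') (-dAdjKernel c μ (Gins w c M) y y') M := by
  have h : HasDerivAt (fun M' : ℝ => dAdjKernel c μ (G w c M') y y')
      (c * (-Gins w c M y (y'.shift μ) - -Gins w c M y y')) M :=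
    ((hasDerivAt_G_apply' w c hw hM y (y'.shift μ)).sub (hasDerivAt_G_apply' w c hw hM y y')).const_mul c
  refine h.congr_deriv ?_
  simp only [dAdjKernel]
  ring

omit C η m2 in
/-- `∂_{M²}(∂_μC₀∂^*_μ)(y,y′) = −(∂_μ(C₀⋆C₀)∂^*_μ)(y,y′)`. [cite: Balaban1983Higgs3, (1.21) p.416] -/
theorem hasDerivAt_dKernel_G (hw : 0 < w) {M : ℝ} (hM : 0 < M) (μ : Fin P.d) (y y' : Site P j) :
    HasDerivAt (fun M' : ℝ => dKernel c μ (G w c M') y y') (-dKernel c μ (Gins w c M) y y') M := by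
  have h : HasDerivAt (fun M' : ℝ => dKernel c μ (G w c M') y y')
      (c ^ 2 * (-Gins w c M (y.shift μ) (y'.shift μ) - -Gins w c M (y.shift μ) y' - -Gins w c M y (y'.shift μ)
        + -Gins w c M y y')) M :=
    ((((hasDerivAt_G_apply' w c hw hM (y.shift μ) (y'.shift μ)).sub
      (hasDerivAt_G_apply' w c hw hM (y.shift μ) y')).sub (hasDerivAt_G_apply' w c hw hM y (y'.shift μ))).add
      (hasDerivAt_G_apply' w c hw hM y y')).const_mul (c ^ 2)
  refine h.congr_deriv ?_
  simp only [dKernel]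
  ring

/-! ### Generic calculus of a «sandwich» `Σ_{y,y′}η^{2d}ℓ(y)ι(y,y′)r(y′)` (a leg, an insertion, a leg) -/

omit C η c m2 in
/-- Leibniz rule for a sandwich of three mass-dependent factors. [folklore] -/
private theorem hasDerivAt_sandwich {ℓ r : ℝ → Site P j → ℝ} {ι : ℝ → Kernel P j} {ℓ' r' : Site P j → ℝ} {ι' : Kernel P j}
    {m : ℝ} (hℓ : ∀ y, HasDerivAt (fun M => ℓ M y) (ℓ' y) m) (hι : ∀ y y', HasDerivAt (fun M => ι M y y') (ι' y y') m)
    (hr : ∀ y', HasDerivAt (fun M => r M y') (r' y') m) :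
    HasDerivAt (fun M => ∑ y : Site P j, ∑ y' : Site P j, w * w * (ℓ M y * ι M y y' * r M y'))
      ((∑ y : Site P j, ∑ y' : Site P j, w * w * (ℓ' y * ι m y y' * r m y'))
        + (∑ y : Site P j, ∑ y' : Site P j, w * w * (ℓ m y * ι' y y' * r m y'))
        + ∑ y : Site P j, ∑ y' : Site P j, w * w * (ℓ m y * ι m y y' * r' y')) m := by
  have h : HasDerivAt (fun M => ∑ y : Site P j, ∑ y' : Site P j, w * w * (ℓ M y * ι M y y' * r M y'))
      (∑ y : Site P j, ∑ y' : Site P j, w * w *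
        ((ℓ' y * ι m y y' + ℓ m y * ι' y y') * r m y' + ℓ m y * ι m y y' * r' y')) m :=
    HasDerivAt.fun_sum (u := (Finset.univ : Finset (Site P j))) fun y _ =>
      HasDerivAt.fun_sum (u := (Finset.univ : Finset (Site P j))) fun y' _ =>
        (((hℓ y).mul (hι y y')).mul (hr y')).const_mul (w * w)
  refine h.congr_deriv ?_
  rw [← Finset.sum_add_distrib, ← Finset.sum_add_distrib]
  refine Finset.sum_congr rfl fun y _ => ?_
  rw [← Finset.sum_add_distrib, ← Finset.sum_add_distrib]
  refine Finset.sum_congr rfl fun y' _ => ?_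
  ring

omit C η c m2 in
/-- a mass insertion on the LEFT leg is a free propagator prepended to the whole sandwich:
`Σ_{y,y′}η^{2d}(−Σ_zη^dK(x,z)Λ(z,y))ι(y,y′)ρ(y′) = −Σ_zη^dK(x,z)·[Σ_{y,y′}η^{2d}Λ(z,y)ι(y,y′)ρ(y′)]`. [folklore] -/
private theorem chain_left (K Λ ι : Kernel P j) (ρ : Site P j → ℝ) (x : Site P j) :
    ∑ y : Site P j, ∑ y' : Site P j, w * w * ((-∑ z : Site P j, w * (K x z * Λ z y)) * ι y y' * ρ y') =
      -∑ z : Site P j, w * (K x z * ∑ y : Site P j, ∑ y' : Site P j, w * w * (Λ z y * ι y y' * ρ y')) := by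
  calc ∑ y : Site P j, ∑ y' : Site P j, w * w * ((-∑ z : Site P j, w * (K x z * Λ z y)) * ι y y' * ρ y')
      = ∑ y : Site P j, ∑ y' : Site P j, ∑ z : Site P j, -(w * (K x z * (w * w * (Λ z y * ι y y' * ρ y')))) := by
        refine Finset.sum_congr rfl fun y _ => Finset.sum_congr rfl fun y' _ => ?_
        rw [neg_mul, neg_mul, mul_neg, Finset.sum_mul, Finset.sum_mul, Finset.mul_sum, ← Finset.sum_neg_distrib]
        exact Finset.sum_congr rfl fun z _ => by ring
    _ = ∑ y : Site P j, ∑ z : Site P j, ∑ y' : Site P j, -(w * (K x z * (w * w * (Λ z y * ι y y' * ρ y')))) :=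
        Finset.sum_congr rfl fun y _ => Finset.sum_comm
    _ = ∑ z : Site P j, ∑ y : Site P j, ∑ y' : Site P j, -(w * (K x z * (w * w * (Λ z y * ι y y' * ρ y')))) :=
        Finset.sum_comm
    _ = _ := by
        rw [← Finset.sum_neg_distrib]
        refine Finset.sum_congr rfl fun z _ => ?_
        rw [Finset.mul_sum, Finset.mul_sum, ← Finset.sum_neg_distrib]
        refine Finset.sum_congr rfl fun y _ => ?_
        rw [Finset.mul_sum, Finset.mul_sum, ← Finset.sum_neg_distrib]

omit C η c m2 in
/-- a mass insertion on the RIGHT leg is a free propagator appended to the whole sandwich: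
`Σ_{y,y′}η^{2d}ℓ(y)ι(y,y′)(−Σ_zη^dΡ(y′,z)K(z,x′)) = −Σ_zη^d[Σ_{y,y′}η^{2d}ℓ(y)ι(y,y′)Ρ(y′,z)]·K(z,x′)`. [folklore] -/
private theorem chain_right (K Ρ ι : Kernel P j) (ℓ : Site P j → ℝ) (x' : Site P j) :
    ∑ y : Site P j, ∑ y' : Site P j, w * w * (ℓ y * ι y y' * -∑ z : Site P j, w * (Ρ y' z * K z x')) =
      -∑ z : Site P j, w * ((∑ y : Site P j, ∑ y' : Site P j, w * w * (ℓ y * ι y y' * Ρ y' z)) * K z x') := by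
  calc ∑ y : Site P j, ∑ y' : Site P j, w * w * (ℓ y * ι y y' * -∑ z : Site P j, w * (Ρ y' z * K z x'))
      = ∑ y : Site P j, ∑ y' : Site P j, ∑ z : Site P j, -(w * (w * w * (ℓ y * ι y y' * Ρ y' z) * K z x')) := by
        refine Finset.sum_congr rfl fun y _ => Finset.sum_congr rfl fun y' _ => ?_
        rw [mul_neg, mul_neg, Finset.mul_sum, Finset.mul_sum, ← Finset.sum_neg_distrib]
        exact Finset.sum_congr rfl fun z _ => by ring
    _ = ∑ y : Site P j, ∑ z : Site P j, ∑ y' : Site P j, -(w * (w * w * (ℓ y * ι y y' * Ρ y' z) * K z x')) :=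
        Finset.sum_congr rfl fun y _ => Finset.sum_comm
    _ = ∑ z : Site P j, ∑ y : Site P j, ∑ y' : Site P j, -(w * (w * w * (ℓ y * ι y y' * Ρ y' z) * K z x')) :=
        Finset.sum_comm
    _ = _ := by
        rw [← Finset.sum_neg_distrib]
        refine Finset.sum_congr rfl fun z _ => ?_
        rw [Finset.sum_mul, Finset.mul_sum, ← Finset.sum_neg_distrib]
        refine Finset.sum_congr rfl fun y _ => ?_
        rw [Finset.sum_mul, Finset.mul_sum, ← Finset.sum_neg_distrib]

/-! ## §3 The sector `e⁰`: `G_{0,ab}(m²+δm²) = C^η_{m²+δm²}δ_{ab}`, its `δm²`-derivative `C₀(−1)C₀`, and the EXACT resolvent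
form of (1.21) with `X = −δm²` -/

section ZeroCharge

variable (μ2 : ℝ)

/-- the standard orthonormal basis vector `e_a` of `R^N` (notation local to this file). [folklore] -/
local notation "𝐞" => EuclideanSpace.basisFun (Fin N) ℝ

/-- **THE COUNTERTERM IS A MASS SHIFT.** In the action (1.20) the scalar mass term `½⟨φ,m²φ⟩` and the counterterm
`Σ_xε^d·½δm²∣φ(x)∣²` add up to `½(m²+δm²)Σ_xε^d∣φ(x)∣²` (r15's typed Feynman-gauge action `LatticeFieldCalculus.feynmanHiggsAction`
carries the single letter `m₀² = m² + δm²`, the typer's `B3Sect1TwoPoint.action120`): the integrand of (1.19) with counterterm `δm²`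
(`λ = 0`) is BRICK 7's joint weight `J` at scalar mass `m² + δm²`, `J = exp(−S^ε)` with `S^ε = feynmanHiggsAction … (m²+δm²) 0 μ₀² 0`.
[cite: Balaban1983Higgs3, (1.19)–(1.20) p.416] -/
theorem J_mass_shift_eq_exp_neg_feynmanHiggsAction (dm2 e : ℝ) (p : JCfg P j N) :
    J C η w c (m2 + dm2) μ2 e p =
      Real.exp (-(feynmanHiggsAction w c ((Ce C e).Urep η) (m2 + dm2) 0 μ2 0 (toVec p.1) p.2)) :=
  J_eq_exp_neg_feynmanHiggsAction C η w c (m2 + dm2) μ2 e p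

/-- **ORDER `e⁰`, ALL ORDERS IN `δm²` AT ONCE**: at `e = 0` the two-point function (1.19) with counterterm `δm²` is the free
propagator of mass `m² + δm²`: `G_{0,ab}(x,x′) = C^η_{m²+δm²}(x′,x)δ_{ab}` (`m² + δm² > 0`). [cite: Balaban1983Higgs3, (1.19), (1.21) p.416] -/
theorem twoPt_zero_mass (hw : 0 < w) (hμ : 0 < μ2) {dm2 : ℝ} (hdm : 0 < m2 + dm2) (a b : Fin N) (x x' : Site P j) :
    twoPt C η w c (m2 + dm2) μ2 0 a b x x' = G w c (m2 + dm2) x' x * ⟪𝐞 a, 𝐞 b⟫_ℝ :=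
  (twoPt_zero C η w c (m2 + dm2) μ2 hw hdm hμ a b x x').1

/-- **ORDER `e⁰δm²`: `∂_{δm²}∣₀G_{0,ab}(x,x′) = −(C₀⋆C₀)(x′,x)δ_{ab}`** — the `n = 1` term `C₀(−δm²)C₀` of (1.21) per unit `δm²`
(the mass vertex (1.7) on the free line), DERIVED from (1.19)/(1.20). [cite: Balaban1983Higgs3, (1.21) p.416] -/
theorem hasDerivAt_twoPt_zero_mass (hw : 0 < w) (hm : 0 < m2) (hμ : 0 < μ2) (a b : Fin N) (x x' : Site P j) :
    HasDerivAt (fun dm2 : ℝ => twoPt C η w c (m2 + dm2) μ2 0 a b x x') (-Gins w c m2 x' x * ⟪𝐞 a, 𝐞 b⟫_ℝ) 0 := by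
  have hG : HasDerivAt (fun dm2 : ℝ => G w c (m2 + dm2) x' x) (-Gins w c m2 x' x) 0 := by
    have h := (hasDerivAt_G_apply' (P := P) (j := j) w c hw (M := m2 + 0) (by rwa [add_zero]) x' x).comp_const_add
      m2 0
    simp only [add_zero] at h
    exact h
  refine (hG.mul_const _).congr_of_eventuallyEq ?_
  have hpos : ∀ᶠ dm2 : ℝ in 𝓝 0, 0 < m2 + dm2 := by
    have : ∀ᶠ dm2 : ℝ in 𝓝 0, dm2 ∈ Set.Ioi (-m2) := Ioi_mem_nhds (by linarith)
    filter_upwards [this] with dm2 h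
    rw [Set.mem_Ioi] at h
    linarith
  filter_upwards [hpos] with dm2 h
  exact twoPt_zero_mass C η w c m2 μ2 hw hμ h a b x x'

omit C η m2 in
/-- **(1.21) HOLDS EXACTLY IN THE PURE-COUNTERTERM SECTOR.** The resolvent identity `C^η_{m²+δm²} = C^η_{m²} +
C^η_{m²+δm²}·(−δm²)·C^η_{m²}` (operators composed with the volume element `η^d`) is r15's resummed form
`B3Sect1TwoPoint.Eq121 G C₀ X` (`G = C₀ + G·X·C₀`) of (1.21) with `G = C^η_{m²+δm²}` (= the two-point function at `e = λ = 0`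
by `twoPt_zero_mass`), `C₀ = C^η_{m²}`, `X = −δm²`, read in the matrix ring through `K ↦ η^d·K` (which turns the `η^d`-weighted
composition of kernels into the matrix product; the multiplication operator `−δm²` becomes `−δm²·1`). Non-perturbative, every
`δm² > −m²`; its iteration is the printed series `Σ_nC₀[(−δm²)C₀]ⁿ` (r15's `dyson_partial`, p32's `B3Eq121DysonSeries`).
[cite: Balaban1983Higgs3, (1.21) p.416] -/
theorem eq121_counterterm (hw : 0 < w) {m2 dm2 : ℝ} (hm : 0 < m2) (hdm : 0 < m2 + dm2) :
    B3Sect1TwoPoint.Eq121 (w • G w c (m2 + dm2)) (w • G w c m2)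
      (-(dm2 • (1 : Matrix (Site P j) (Site P j) ℝ))) := by
  unfold B3Sect1TwoPoint.Eq121
  simp only [Matrix.mul_neg, neg_mul, Matrix.mul_smul, Matrix.smul_mul, Matrix.mul_one, smul_smul]
  ext x y
  have h := G_sub_G_apply w c hw hdm hm x y
  rw [← Finset.mul_sum] at h
  simp only [Matrix.add_apply, Matrix.neg_apply, Matrix.smul_apply, smul_eq_mul, Matrix.mul_apply]
  linear_combination w * h

omit C η m2 in
/-- the same identity as kernels: `C_{m²+δm²}(x,y) = C_{m²}(x,y) − δm²·Σ_zη^dC_{m²+δm²}(x,z)C_{m²}(z,y)`.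
[cite: Balaban1983Higgs3, (1.21) p.416] -/
theorem G_mass_shift_eq (hw : 0 < w) {m2 dm2 : ℝ} (hm : 0 < m2) (hdm : 0 < m2 + dm2) (x y : Site P j) :
    G w c (m2 + dm2) x y = G w c m2 x y - dm2 * ∑ z : Site P j, w * (G w c (m2 + dm2) x z * G w c m2 z y) := by
  have h := G_sub_G_apply w c hw hdm hm x y
  linear_combination h

end ZeroCharge

/-! ## §4 The sector `e²δm²`: the mass derivative of BRICK 7's derived order-`e²` structure -/

section SecondOrderMass

variable (μ2 : ℝ)

/-- the standard orthonormal basis vector `e_a` of `R^N` (notation local to this file). [folklore] -/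
local notation "𝐞" => EuclideanSpace.basisFun (Fin N) ℝ

/-! ### The insertions at scalar mass `M` and their mass derivatives -/

omit C η m2 in
/-- **② + ④ at scalar mass `M²`** — p26's `sig2 D + sig4 D` for the data `D` with `D.C0 = C^η_{M²}`, written out:
`e²dC^ε(y,y)q²δ^ε(y−y′) − e²Σ_μq²(∂_μC^η_{M²}∂^*_μ)(y,y′)C^ε(y,y′)`. [cite: Balaban1983Higgs3, (1.22) terms ②, ④ p.416] -/
def ins24 (e Q M : ℝ) : Kernel P j := fun y y' =>
  e ^ 2 * (P.d : ℝ) * G w c μ2 y y * Q * delta w y y'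
    + -(e ^ 2) * ∑ μ : Fin P.d, Q * dKernel c μ (G w c M) y y' * G w c μ2 y y'

omit C η in
/-- **⑦ per unit `δm²`**: `e²Σ_μq²(∂_μ(C₀⋆C₀)∂^*_μ)(y,y′)C^ε(y,y′)` — the graph ④ with the mass vertex on its scalar line
(`= sig7 D 1`, `ins7_eq_sig7`). [cite: Balaban1983Higgs3, (1.22) term ⑦ p.416] -/
def ins7 (e Q : ℝ) : Kernel P j := fun y y' =>
  e ^ 2 * ∑ μ : Fin P.d, Q * dKernel c μ (Gins w c m2) y y' * G w c μ2 y y'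

omit C η in
/-- **`Σ₁,μ` WITH THE MASS VERTEX ON ITS INTERNAL SCALAR LINE** (per unit `δm²`): `−e²q²((C₀⋆C₀)∂^{ε*}_μ)(y,y′)C^ε(y,y′)` — the
`δm²`-derivative of BRICK 7's derived `sgOne` (its local tadpole part carries no scalar line). The paper does not display `Σ₁^ε`;
this is what the Feynman rules of (1.20) give at order `e²δm²`. [cite: Balaban1983Higgs3, (1.21) p.416] -/
def sgOneIns (e Q : ℝ) (μ : Fin P.d) : Kernel P j := fun y y' =>
  -(e ^ 2 * Q * (dAdjKernel c μ (Gins w c m2) y y' * G w c μ2 y y'))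

omit C η in
/-- **`Σ₂` WITH THE MASS VERTEX ON ITS INTERNAL SCALAR LINE** (per unit `δm²`): `e²q²(C₀⋆C₀)(y,y′)C^ε(y,y′)` — the
`δm²`-derivative of BRICK 7's derived `sgTwo`. [cite: Balaban1983Higgs3, (1.21) p.416] -/
def sgTwoIns (e Q : ℝ) : Kernel P j := fun y y' => e ^ 2 * Q * (Gins w c m2 y y' * G w c μ2 y y')

omit C η in
/-- `∂_{M²}(② + ④) = ⑦` per unit `δm²` (② carries no scalar line). [cite: Balaban1983Higgs3, (1.22) terms ②, ④, ⑦ p.416] -/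
theorem hasDerivAt_ins24 (hw : 0 < w) (hm : 0 < m2) (e Q : ℝ) (y y' : Site P j) :
    HasDerivAt (fun M : ℝ => ins24 w c μ2 e Q M y y') (ins7 w c m2 μ2 e Q y y') m2 := by
  have h : HasDerivAt (fun M : ℝ => ins24 w c μ2 e Q M y y')
      (0 + -(e ^ 2) * ∑ μ : Fin P.d, Q * -dKernel c μ (Gins w c m2) y y' * G w c μ2 y y') m2 :=
    (hasDerivAt_const m2 _).add ((HasDerivAt.fun_sum (u := (Finset.univ : Finset (Fin P.d))) fun μ _ =>
      ((hasDerivAt_dKernel_G w c hw hm μ y y').const_mul Q).mul_const _).const_mul _)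
  refine h.congr_deriv ?_
  rw [zero_add, ins7, Finset.mul_sum, Finset.mul_sum]
  exact Finset.sum_congr rfl fun μ _ => by ring

omit C in
/-- `∂_{M²}Σ₁,μ = sgOneIns`. [cite: Balaban1983Higgs3, (1.21) p.416] -/
theorem hasDerivAt_sgOne (hw : 0 < w) (hm : 0 < m2) (e Q : ℝ) (μ : Fin P.d) (y y' : Site P j) :
    HasDerivAt (fun M : ℝ => sgOne η w c M μ2 e Q μ y y') (sgOneIns w c m2 μ2 e Q μ y y') m2 := by
  have h : HasDerivAt (fun M : ℝ => sgOne η w c M μ2 e Q μ y y')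
      (e ^ 2 * Q * (0 + -dAdjKernel c μ (Gins w c m2) y y' * G w c μ2 y y')) m2 :=
    ((hasDerivAt_const m2 _).add ((hasDerivAt_dAdjKernel_G w c hw hm μ y y').mul_const _)).const_mul _
  refine h.congr_deriv ?_
  rw [zero_add, sgOneIns, neg_mul, mul_neg]

omit C η in
/-- `∂_{M²}Σ₂ = sgTwoIns`. [cite: Balaban1983Higgs3, (1.21) p.416] -/
theorem hasDerivAt_sgTwo (hw : 0 < w) (hm : 0 < m2) (e Q : ℝ) (y y' : Site P j) :
    HasDerivAt (fun M : ℝ => sgTwo w c M μ2 e Q y y') (sgTwoIns w c m2 μ2 e Q y y') m2 := by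
  have h : HasDerivAt (fun M : ℝ => sgTwo w c M μ2 e Q y y')
      (-(e ^ 2 * Q * (-Gins w c m2 y y' * G w c μ2 y y'))) m2 :=
    (((hasDerivAt_G_apply' w c hw hm y y').mul_const _).const_mul _).neg
  refine h.congr_deriv ?_
  rw [sgTwoIns, neg_mul, mul_neg, neg_neg]

omit C η m2 in
/-- the differentiated leg `(∂_μC₀)(y,x)`: its mass derivative in chain form (insertion prepended).
[cite: Balaban1983Higgs3, (1.21) p.416] -/
theorem hasDerivAt_d1Kernel_G_left (hw : 0 < w) {M : ℝ} (hM : 0 < M) (μ : Fin P.d) (y x : Site P j) :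
    HasDerivAt (fun M' : ℝ => d1Kernel c μ (G w c M') y x)
      (-∑ z : Site P j, w * (G w c M x z * d1Kernel c μ (G w c M) y z)) M :=
  (hasDerivAt_d1Kernel_G w c hw hM μ y x).congr_deriv (by rw [d1Kernel_Gins'])

omit C η m2 in
/-- the differentiated leg `(∂_μC₀)(y′,x′)`: its mass derivative in chain form (insertion appended).
[cite: Balaban1983Higgs3, (1.21) p.416] -/
theorem hasDerivAt_d1Kernel_G_right (hw : 0 < w) {M : ℝ} (hM : 0 < M) (μ : Fin P.d) (y' x' : Site P j) :
    HasDerivAt (fun M' : ℝ => d1Kernel c μ (G w c M') y' x')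
      (-∑ z : Site P j, w * (d1Kernel c μ (G w c M) y' z * G w c M z x')) M :=
  (hasDerivAt_d1Kernel_G w c hw hM μ y' x').congr_deriv (by rw [d1Kernel_Gins])

/-! ### The four sandwiches of the derived order-e² structure at scalar mass `M`, and their insertion counterparts -/

omit C η m2 in
/-- `C₀[② + ④]C₀` at scalar mass `M²`: `Σ_{y,y′}η^{2d}C_M(x,y)(②+④)_M(y,y′)C_M(y′,x′)`. [cite: Balaban1983Higgs3, (1.21)–(1.22) p.416] -/
def S0 (e Q M : ℝ) (x x' : Site P j) : ℝ :=
  ∑ y : Site P j, ∑ y' : Site P j, w * w * (G w c M x y * ins24 w c μ2 e Q M y y' * G w c M y' x')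

omit C m2 in
/-- the kernel of `C₀∂^{ε*}_μΣ₁,μC₀` at scalar mass `M²`. [cite: Balaban1983Higgs3, (1.21) p.416] -/
def S1 (e Q M : ℝ) (μ : Fin P.d) (x x' : Site P j) : ℝ :=
  ∑ y : Site P j, ∑ y' : Site P j, w * w * (d1Kernel c μ (G w c M) y x * sgOne η w c M μ2 e Q μ y y' * G w c M y' x')

omit C m2 in
/-- the kernel of `C₀Σ₁,μ^*∂^ε_μC₀` at scalar mass `M²`. [cite: Balaban1983Higgs3, (1.21) p.416] -/
def S2 (e Q M : ℝ) (μ : Fin P.d) (x x' : Site P j) : ℝ :=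
  ∑ y : Site P j, ∑ y' : Site P j, w * w * (G w c M x y * sgOne η w c M μ2 e Q μ y' y * d1Kernel c μ (G w c M) y' x')

omit C η m2 in
/-- the kernel of `C₀∂^{ε*}_μΣ₂∂^ε_μC₀` at scalar mass `M²`. [cite: Balaban1983Higgs3, (1.21) p.416] -/
def S3 (e Q M : ℝ) (μ : Fin P.d) (x x' : Site P j) : ℝ :=
  ∑ y : Site P j, ∑ y' : Site P j, w * w *
    (d1Kernel c μ (G w c M) y x * sgTwo w c M μ2 e Q y y' * d1Kernel c μ (G w c M) y' x')

omit C m2 in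
/-- **BRICK 7's DERIVED ORDER-e² KERNEL `(e²/2)∂²_e∣₀G_{ab}(x,x′)` AS AN EXPLICIT FUNCTION OF THE SCALAR MASS `M²`**:
`C₀[②+④]C₀ + Σ_μ(C₀∂^*_μΣ₁,μC₀ + C₀Σ₁,μ^*∂_μC₀ + C₀∂^*_μΣ₂∂_μC₀)` (`secondOrder_eq_E2`). [cite: Balaban1983Higgs3, (1.21) p.416] -/
def E2 (e Q M : ℝ) (x x' : Site P j) : ℝ :=
  S0 w c μ2 e Q M x x' + ∑ μ : Fin P.d, (S1 η w c μ2 e Q M μ x x' + S2 η w c μ2 e Q M μ x x' + S3 w c μ2 e Q M μ x x')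

omit C η in
/-- `C₀·⑦·C₀` per unit `δm²`. [cite: Balaban1983Higgs3, (1.22) term ⑦ p.416] -/
def S0ins (e Q : ℝ) (x x' : Site P j) : ℝ :=
  ∑ y : Site P j, ∑ y' : Site P j, w * w * (G w c m2 x y * ins7 w c m2 μ2 e Q y y' * G w c m2 y' x')

omit C η in
/-- the kernel of `C₀∂^{ε*}_μΣ⁽⁷⁾₁,μC₀` (mass vertex on the internal line of `Σ₁,μ`). [cite: Balaban1983Higgs3, (1.21) p.416] -/
def S1ins (e Q : ℝ) (μ : Fin P.d) (x x' : Site P j) : ℝ :=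
  ∑ y : Site P j, ∑ y' : Site P j, w * w *
    (d1Kernel c μ (G w c m2) y x * sgOneIns w c m2 μ2 e Q μ y y' * G w c m2 y' x')

omit C η in
/-- the kernel of `C₀Σ⁽⁷⁾₁,μ^*∂^ε_μC₀`. [cite: Balaban1983Higgs3, (1.21) p.416] -/
def S2ins (e Q : ℝ) (μ : Fin P.d) (x x' : Site P j) : ℝ :=
  ∑ y : Site P j, ∑ y' : Site P j, w * w *
    (G w c m2 x y * sgOneIns w c m2 μ2 e Q μ y' y * d1Kernel c μ (G w c m2) y' x')

omit C η in
/-- the kernel of `C₀∂^{ε*}_μΣ⁽⁷⁾₂∂^ε_μC₀`. [cite: Balaban1983Higgs3, (1.21) p.416] -/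
def S3ins (e Q : ℝ) (μ : Fin P.d) (x x' : Site P j) : ℝ :=
  ∑ y : Site P j, ∑ y' : Site P j, w * w *
    (d1Kernel c μ (G w c m2) y x * sgTwoIns w c m2 μ2 e Q y y' * d1Kernel c μ (G w c m2) y' x')

omit C η in
/-- **THE `n = 1` TERM OF (1.21) AT ORDER `e²δm²` (per unit `δm²`)**:
`C₀[⑦ + Σ_μ(∂^{ε*}_μΣ⁽⁷⁾₁,μ + Σ⁽⁷⁾₁,μ^*∂^ε_μ) + ∂^{ε*}_μΣ⁽⁷⁾₂∂^ε_μ]C₀` as a kernel. [cite: Balaban1983Higgs3, (1.21)–(1.22) p.416] -/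
def Ins7 (e Q : ℝ) (x x' : Site P j) : ℝ :=
  S0ins w c m2 μ2 e Q x x'
    + ∑ μ : Fin P.d, (S1ins w c m2 μ2 e Q μ x x' + S2ins w c m2 μ2 e Q μ x x' + S3ins w c m2 μ2 e Q μ x x')

/-! ### Family by family: Leibniz, then the two leg insertions become chains -/

omit C η in
/-- `∂_{M²}(C₀[②+④]C₀) = −C₀⋆(C₀[②+④]C₀) + C₀·⑦·C₀ − (C₀[②+④]C₀)⋆C₀`. [cite: Balaban1983Higgs3, (1.21)–(1.22) p.416] -/
theorem hasDerivAt_S0 (hw : 0 < w) (hm : 0 < m2) (e Q : ℝ) (x x' : Site P j) :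
    HasDerivAt (fun M : ℝ => S0 w c μ2 e Q M x x')
      ((-∑ z : Site P j, w * (G w c m2 x z * S0 w c μ2 e Q m2 z x')) + S0ins w c m2 μ2 e Q x x'
        + -∑ z : Site P j, w * (S0 w c μ2 e Q m2 x z * G w c m2 z x')) m2 := by
  have h := hasDerivAt_sandwich (P := P) (j := j) w
    (ℓ := fun M y => G w c M x y) (ι := fun M => ins24 w c μ2 e Q M) (r := fun M y' => G w c M y' x')
    (ℓ' := fun y => -∑ z : Site P j, w * (G w c m2 x z * G w c m2 z y)) (ι' := ins7 w c m2 μ2 e Q)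
    (r' := fun y' => -∑ z : Site P j, w * (G w c m2 y' z * G w c m2 z x')) (m := m2)
    (fun y => hasDerivAt_G_apply w c hw hm x y) (fun y y' => hasDerivAt_ins24 w c m2 μ2 hw hm e Q y y')
    (fun y' => hasDerivAt_G_apply w c hw hm y' x')
  refine h.congr_deriv ?_
  rw [chain_left w (G w c m2) (G w c m2) (ins24 w c μ2 e Q m2) (fun y' => G w c m2 y' x') x,
    chain_right w (G w c m2) (G w c m2) (ins24 w c μ2 e Q m2) (fun y => G w c m2 x y) x']
  rfl

omit C in
/-- `∂_{M²}(C₀∂^*_μΣ₁,μC₀) = −C₀⋆(…) + C₀∂^*_μΣ⁽⁷⁾₁,μC₀ − (…)⋆C₀`. [cite: Balaban1983Higgs3, (1.21) p.416] -/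
theorem hasDerivAt_S1 (hw : 0 < w) (hm : 0 < m2) (e Q : ℝ) (μ : Fin P.d) (x x' : Site P j) :
    HasDerivAt (fun M : ℝ => S1 η w c μ2 e Q M μ x x')
      ((-∑ z : Site P j, w * (G w c m2 x z * S1 η w c μ2 e Q m2 μ z x')) + S1ins w c m2 μ2 e Q μ x x'
        + -∑ z : Site P j, w * (S1 η w c μ2 e Q m2 μ x z * G w c m2 z x')) m2 := by
  have h := hasDerivAt_sandwich (P := P) (j := j) w
    (ℓ := fun M y => d1Kernel c μ (G w c M) y x) (ι := fun M => sgOne η w c M μ2 e Q μ)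
    (r := fun M y' => G w c M y' x')
    (ℓ' := fun y => -∑ z : Site P j, w * (G w c m2 x z * d1Kernel c μ (G w c m2) y z))
    (ι' := sgOneIns w c m2 μ2 e Q μ)
    (r' := fun y' => -∑ z : Site P j, w * (G w c m2 y' z * G w c m2 z x')) (m := m2)
    (fun y => hasDerivAt_d1Kernel_G_left w c hw hm μ y x) (fun y y' => hasDerivAt_sgOne η w c m2 μ2 hw hm e Q μ y y')
    (fun y' => hasDerivAt_G_apply w c hw hm y' x')
  refine h.congr_deriv ?_
  rw [chain_left w (G w c m2) (fun z y => d1Kernel c μ (G w c m2) y z) (sgOne η w c m2 μ2 e Q μ)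
      (fun y' => G w c m2 y' x') x,
    chain_right w (G w c m2) (G w c m2) (sgOne η w c m2 μ2 e Q μ) (fun y => d1Kernel c μ (G w c m2) y x) x']
  rfl

omit C in
/-- `∂_{M²}(C₀Σ₁,μ^*∂_μC₀) = −C₀⋆(…) + C₀Σ⁽⁷⁾₁,μ^*∂_μC₀ − (…)⋆C₀`. [cite: Balaban1983Higgs3, (1.21) p.416] -/
theorem hasDerivAt_S2 (hw : 0 < w) (hm : 0 < m2) (e Q : ℝ) (μ : Fin P.d) (x x' : Site P j) :
    HasDerivAt (fun M : ℝ => S2 η w c μ2 e Q M μ x x')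
      ((-∑ z : Site P j, w * (G w c m2 x z * S2 η w c μ2 e Q m2 μ z x')) + S2ins w c m2 μ2 e Q μ x x'
        + -∑ z : Site P j, w * (S2 η w c μ2 e Q m2 μ x z * G w c m2 z x')) m2 := by
  have h := hasDerivAt_sandwich (P := P) (j := j) w
    (ℓ := fun M y => G w c M x y) (ι := fun M y y' => sgOne η w c M μ2 e Q μ y' y)
    (r := fun M y' => d1Kernel c μ (G w c M) y' x')
    (ℓ' := fun y => -∑ z : Site P j, w * (G w c m2 x z * G w c m2 z y))
    (ι' := fun y y' => sgOneIns w c m2 μ2 e Q μ y' y)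
    (r' := fun y' => -∑ z : Site P j, w * (d1Kernel c μ (G w c m2) y' z * G w c m2 z x')) (m := m2)
    (fun y => hasDerivAt_G_apply w c hw hm x y) (fun y y' => hasDerivAt_sgOne η w c m2 μ2 hw hm e Q μ y' y)
    (fun y' => hasDerivAt_d1Kernel_G_right w c hw hm μ y' x')
  refine h.congr_deriv ?_
  rw [chain_left w (G w c m2) (G w c m2) (fun y y' => sgOne η w c m2 μ2 e Q μ y' y)
      (fun y' => d1Kernel c μ (G w c m2) y' x') x,
    chain_right w (G w c m2) (fun y' z => d1Kernel c μ (G w c m2) y' z) (fun y y' => sgOne η w c m2 μ2 e Q μ y' y)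
      (fun y => G w c m2 x y) x']
  rfl

omit C η in
/-- `∂_{M²}(C₀∂^*_μΣ₂∂_μC₀) = −C₀⋆(…) + C₀∂^*_μΣ⁽⁷⁾₂∂_μC₀ − (…)⋆C₀`. [cite: Balaban1983Higgs3, (1.21) p.416] -/
theorem hasDerivAt_S3 (hw : 0 < w) (hm : 0 < m2) (e Q : ℝ) (μ : Fin P.d) (x x' : Site P j) :
    HasDerivAt (fun M : ℝ => S3 w c μ2 e Q M μ x x')
      ((-∑ z : Site P j, w * (G w c m2 x z * S3 w c μ2 e Q m2 μ z x')) + S3ins w c m2 μ2 e Q μ x x'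
        + -∑ z : Site P j, w * (S3 w c μ2 e Q m2 μ x z * G w c m2 z x')) m2 := by
  have h := hasDerivAt_sandwich (P := P) (j := j) w
    (ℓ := fun M y => d1Kernel c μ (G w c M) y x) (ι := fun M => sgTwo w c M μ2 e Q)
    (r := fun M y' => d1Kernel c μ (G w c M) y' x')
    (ℓ' := fun y => -∑ z : Site P j, w * (G w c m2 x z * d1Kernel c μ (G w c m2) y z))
    (ι' := sgTwoIns w c m2 μ2 e Q)
    (r' := fun y' => -∑ z : Site P j, w * (d1Kernel c μ (G w c m2) y' z * G w c m2 z x')) (m := m2)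
    (fun y => hasDerivAt_d1Kernel_G_left w c hw hm μ y x) (fun y y' => hasDerivAt_sgTwo w c m2 μ2 hw hm e Q y y')
    (fun y' => hasDerivAt_d1Kernel_G_right w c hw hm μ y' x')
  refine h.congr_deriv ?_
  rw [chain_left w (G w c m2) (fun z y => d1Kernel c μ (G w c m2) y z) (sgTwo w c m2 μ2 e Q)
      (fun y' => d1Kernel c μ (G w c m2) y' x') x,
    chain_right w (G w c m2) (fun y' z => d1Kernel c μ (G w c m2) y' z) (sgTwo w c m2 μ2 e Q)
      (fun y => d1Kernel c μ (G w c m2) y x) x']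
  rfl

/-! ### Assembly: the leg insertions of all four families regroup into `−(C₀⋆T + T⋆C₀)` -/

omit C η c m2 in
/-- linearity of `F ↦ −Σ_zη^dK(z)F(z)` over the shape `A + Σ_μ(B₁+B₂+B₃)`. [folklore] -/
private theorem neg_sum_mul_add₄ (K A : Site P j → ℝ) (B₁ B₂ B₃ : Fin P.d → Site P j → ℝ) :
    -∑ z : Site P j, w * (K z * (A z + ∑ μ : Fin P.d, (B₁ μ z + B₂ μ z + B₃ μ z))) =
      -∑ z : Site P j, w * (K z * A z)
        + ∑ μ : Fin P.d, (-∑ z : Site P j, w * (K z * B₁ μ z) + -∑ z : Site P j, w * (K z * B₂ μ z)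
            + -∑ z : Site P j, w * (K z * B₃ μ z)) := by
  have h1 : ∀ z : Site P j, w * (K z * (A z + ∑ μ : Fin P.d, (B₁ μ z + B₂ μ z + B₃ μ z))) =
      w * (K z * A z) + ∑ μ : Fin P.d, (w * (K z * B₁ μ z) + w * (K z * B₂ μ z) + w * (K z * B₃ μ z)) := by
    intro z
    rw [mul_add, mul_add, Finset.mul_sum, Finset.mul_sum]
    congr 1
    exact Finset.sum_congr rfl fun μ _ => by ring
  simp_rw [h1]
  rw [Finset.sum_add_distrib, Finset.sum_comm, neg_add]
  congr 1
  rw [← Finset.sum_neg_distrib]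
  refine Finset.sum_congr rfl fun μ _ => ?_
  rw [Finset.sum_add_distrib, Finset.sum_add_distrib, neg_add, neg_add]

omit C η c m2 in
/-- linearity of `F ↦ −Σ_zη^dF(z)K(z)` over the shape `A + Σ_μ(B₁+B₂+B₃)`. [folklore] -/
private theorem neg_sum_add_mul₄ (K A : Site P j → ℝ) (B₁ B₂ B₃ : Fin P.d → Site P j → ℝ) :
    -∑ z : Site P j, w * ((A z + ∑ μ : Fin P.d, (B₁ μ z + B₂ μ z + B₃ μ z)) * K z) =
      -∑ z : Site P j, w * (A z * K z)
        + ∑ μ : Fin P.d, (-∑ z : Site P j, w * (B₁ μ z * K z) + -∑ z : Site P j, w * (B₂ μ z * K z)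
            + -∑ z : Site P j, w * (B₃ μ z * K z)) := by
  have h1 : ∀ z : Site P j, w * ((A z + ∑ μ : Fin P.d, (B₁ μ z + B₂ μ z + B₃ μ z)) * K z) =
      w * (A z * K z) + ∑ μ : Fin P.d, (w * (B₁ μ z * K z) + w * (B₂ μ z * K z) + w * (B₃ μ z * K z)) := by
    intro z
    rw [add_mul, mul_add, Finset.sum_mul, Finset.mul_sum]
    congr 1
    exact Finset.sum_congr rfl fun μ _ => by ring
  simp_rw [h1]
  rw [Finset.sum_add_distrib, Finset.sum_comm, neg_add]
  congr 1
  rw [← Finset.sum_neg_distrib]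
  refine Finset.sum_congr rfl fun μ _ => ?_
  rw [Finset.sum_add_distrib, Finset.sum_add_distrib, neg_add, neg_add]

omit C in
/-- **`∂_{M²}E2 = −(C₀⋆E2 + E2⋆C₀) + Ins7`** at `M² = m²`: the mass insertions on the two legs of every family are free
propagators prepended or appended to the whole order-e² kernel (the `n = 2` cross terms of (1.21)), the insertions on the internal
scalar lines are the `n = 1` term at order `e²δm²`. [cite: Balaban1983Higgs3, (1.21)–(1.22) p.416] -/
theorem hasDerivAt_E2 (hw : 0 < w) (hm : 0 < m2) (e Q : ℝ) (x x' : Site P j) :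
    HasDerivAt (fun M : ℝ => E2 η w c μ2 e Q M x x')
      ((-∑ z : Site P j, w * (G w c m2 x z * E2 η w c μ2 e Q m2 z x')) + Ins7 w c m2 μ2 e Q x x'
        + -∑ z : Site P j, w * (E2 η w c μ2 e Q m2 x z * G w c m2 z x')) m2 := by
  have h : HasDerivAt (fun M : ℝ => E2 η w c μ2 e Q M x x') _ m2 :=
    (hasDerivAt_S0 w c m2 μ2 hw hm e Q x x').add
      (HasDerivAt.fun_sum (u := (Finset.univ : Finset (Fin P.d))) fun μ _ =>
        ((hasDerivAt_S1 η w c m2 μ2 hw hm e Q μ x x').add (hasDerivAt_S2 η w c m2 μ2 hw hm e Q μ x x')).add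
          (hasDerivAt_S3 w c m2 μ2 hw hm e Q μ x x'))
  refine h.congr_deriv ?_
  simp only [E2, Ins7]
  rw [neg_sum_mul_add₄ w (fun z => G w c m2 x z) (fun z => S0 w c μ2 e Q m2 z x')
      (fun μ z => S1 η w c μ2 e Q m2 μ z x') (fun μ z => S2 η w c μ2 e Q m2 μ z x') (fun μ z => S3 w c μ2 e Q m2 μ z x'),
    neg_sum_add_mul₄ w (fun z => G w c m2 z x') (fun z => S0 w c μ2 e Q m2 x z)
      (fun μ z => S1 η w c μ2 e Q m2 μ x z) (fun μ z => S2 η w c μ2 e Q m2 μ x z) (fun μ z => S3 w c μ2 e Q m2 μ x z)]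
  simp only [Finset.sum_add_distrib]
  abel

end SecondOrderMass

/-! ## §5 THE ORDER `e²δm²` OF (1.19)/(1.20): `−(C₀⋆T + T⋆C₀) + C₀[⑦ + Σ_μ(∂^*Σ⁽⁷⁾₁,μ + Σ⁽⁷⁾ᵀ₁,μ∂) + ∂^*Σ⁽⁷⁾₂∂]C₀` -/

section MainTheorem

variable (μ2 : ℝ)

/-- the standard orthonormal basis vector `e_a` of `R^N` (notation local to this file). [folklore] -/
local notation "𝐞" => EuclideanSpace.basisFun (Fin N) ℝ

omit C η c m2 μ2 in
/-- regrouping `Σ_{y,y′}Σ_μη^{2d}(A+B+C)` by the direction `μ`. [folklore] -/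
private theorem sum_sites_dir_comm₃ (F₁ F₂ F₃ : Fin P.d → Site P j → Site P j → ℝ) :
    ∑ y : Site P j, ∑ y' : Site P j, ∑ μ : Fin P.d, w * w * (F₁ μ y y' + F₂ μ y y' + F₃ μ y y') =
      ∑ μ : Fin P.d, ((∑ y : Site P j, ∑ y' : Site P j, w * w * F₁ μ y y')
        + (∑ y : Site P j, ∑ y' : Site P j, w * w * F₂ μ y y') + ∑ y : Site P j, ∑ y' : Site P j, w * w * F₃ μ y y') := by
  calc ∑ y : Site P j, ∑ y' : Site P j, ∑ μ : Fin P.d, w * w * (F₁ μ y y' + F₂ μ y y' + F₃ μ y y')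
      = ∑ y : Site P j, ∑ μ : Fin P.d, ∑ y' : Site P j, w * w * (F₁ μ y y' + F₂ μ y y' + F₃ μ y y') :=
        Finset.sum_congr rfl fun y _ => Finset.sum_comm
    _ = ∑ μ : Fin P.d, ∑ y : Site P j, ∑ y' : Site P j, w * w * (F₁ μ y y' + F₂ μ y y' + F₃ μ y y') := Finset.sum_comm
    _ = _ := by
        refine Finset.sum_congr rfl fun μ _ => ?_
        simp only [mul_add, Finset.sum_add_distrib]

/-- **BRICK 7's derived order-e² structure holds at EVERY scalar mass, and is the explicit `E2`.** For p26's data `D` of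
(1.22) with `D.e = e`, `D.q2 = (q²)_{ab}`, `D.C = C^ε`, `D.w = η^d`, `D.c = η⁻¹` (the scalar propagator slot is re-instantiated
at mass `M²`): `(e²/2)∂²_e∣₀G_{ab}(x,x′; M²) = E2(M²)(x,x′)` (`B3Eq122ChargeWick.secondOrder_eq_structure121` at `C₀ := C^η_{M²}`).
[cite: Balaban1983Higgs3, (1.19)–(1.22) p.416] -/
theorem secondOrder_eq_E2 (hw : 0 < w) (hμ : 0 < μ2) (hcη : c * η = 1) (e : ℝ) (a b : Fin N) (D : SEData P j)
    (he : D.e = e) (hq : D.q2 = ⟪𝐞 a, C.q (C.q (𝐞 b))⟫_ℝ) (hC : D.C = G w c μ2) (hwD : D.w = w) (hcD : D.c = c)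
    {M : ℝ} (hM : 0 < M) (x x' : Site P j) :
    e ^ 2 / 2 * iteratedDeriv 2 (fun s => twoPt C η w c M μ2 s a b x x') 0 =
      E2 η w c μ2 e ⟪𝐞 a, C.q (C.q (𝐞 b))⟫_ℝ M x x' := by
  have hwD' : D.ε ^ P.d = w := hwD
  have hcD' : D.ε⁻¹ = c := hcD
  have h := secondOrder_eq_structure121 C η w c M μ2 hw hM hμ hcη e a b ({ D with C0 := G w c M }) he hq rfl hC hwD hcD
    x x'
  rw [h, E2]
  simp only [S0, S1, S2, S3, ins24, sig2, sig4, SEData.w, SEData.c, he, hq, hC, hwD', hcD']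
  congr 1
  exact sum_sites_dir_comm₃ w _ _ _

omit C η in
/-- **THE DICTIONARY TO p26's TYPED ⑦**: the mass derivative of ② + ④ IS `sig7 D 1` — p26's
`B3Eq123Counterterms.sig7 D dm2 = e²Σ_μΣ_{x″}ε^dq²(∂^ε_μC₀)(x−x″)·dm2(x″)·(C₀∂^{ε*}_μ)(x″−x′)C^ε(x−x′)` at the constant site
function `dm2 ≡ 1` (⑦ per unit `δm²`): the print's sign `+e²` and the absence of any further combinatoric factor in ⑦ are what
the mass-insertion identity gives from ④. [cite: Balaban1983Higgs3, (1.22) terms ④, ⑦ p.416] -/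
theorem ins7_eq_sig7 (e Q : ℝ) (D : SEData P j) (he : D.e = e) (hq : D.q2 = Q) (hC0 : D.C0 = G w c m2)
    (hC : D.C = G w c μ2) (hwD : D.w = w) (hcD : D.c = c) (y y' : Site P j) :
    ins7 w c m2 μ2 e Q y y' = sig7 D (fun _ => (1 : ℝ)) y y' := by
  have hwD' : D.ε ^ P.d = w := hwD
  have hcD' : D.ε⁻¹ = c := hcD
  simp only [ins7, sig7, SEData.w, SEData.c, he, hq, hC0, hC, hwD', hcD', dKernel_Gins, mul_one, Finset.mul_sum,
    Finset.sum_mul]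
  exact Finset.sum_congr rfl fun μ _ => Finset.sum_congr rfl fun z _ => by ring

omit C η w c m2 μ2 in
/-- ⑦ is linear in the inserted counterterm: at the constant site function `δm²`, `sig7 D δm² = δm²·(sig7 D 1)` (print inserts
the NUMBER `δm²` at the vertex (1.7), p. 416 *"(1.7) [with δm² instead of δm²_l(x)]"*). [cite: Balaban1983Higgs3, (1.22) term ⑦ p.416] -/
theorem sig7_const (D : SEData P j) (r : ℝ) (y y' : Site P j) :
    sig7 D (fun _ => r) y y' = r * sig7 D (fun _ => (1 : ℝ)) y y' := by
  simp only [sig7, mul_one, Finset.mul_sum]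
  exact Finset.sum_congr rfl fun μ _ => Finset.sum_congr rfl fun z _ => by ring

omit C η in
/-- hence **`δm²·ins7 = sig7 D δm²` — THE PRINTED ⑦ `e²Σ_μΣ_{x″}ε^dq(∂^ε_μC^ε_0)(x−x″)δm²(C^ε_0∂^{ε*}_μ)(x″−x′)qC^ε(x−x′)`
with its `δm²`**, as typed by p26. [cite: Balaban1983Higgs3, (1.22) term ⑦ p.416] -/
theorem dm2_mul_ins7_eq_sig7 (e Q dm2 : ℝ) (D : SEData P j) (he : D.e = e) (hq : D.q2 = Q) (hC0 : D.C0 = G w c m2)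
    (hC : D.C = G w c μ2) (hwD : D.w = w) (hcD : D.c = c) (y y' : Site P j) :
    dm2 * ins7 w c m2 μ2 e Q y y' = sig7 D (fun _ => dm2) y y' := by
  rw [ins7_eq_sig7 w c m2 μ2 e Q D he hq hC0 hC hwD hcD, sig7_const D dm2]

omit C η in
/-- `Ins7` with its first sandwich written through p26's `sig7`:
`Ins7 = Σ_{y,y′}η^{2d}C₀(x,y)·(sig7 D 1)(y,y′)·C₀(y′,x′) + Σ_μ(S1ins + S2ins + S3ins)`. [cite: Balaban1983Higgs3, (1.21)–(1.22) p.416] -/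
theorem Ins7_eq_sig7 (e Q : ℝ) (D : SEData P j) (he : D.e = e) (hq : D.q2 = Q) (hC0 : D.C0 = G w c m2)
    (hC : D.C = G w c μ2) (hwD : D.w = w) (hcD : D.c = c) (x x' : Site P j) :
    Ins7 w c m2 μ2 e Q x x' =
      (∑ y : Site P j, ∑ y' : Site P j, w * w * (G w c m2 x y * sig7 D (fun _ => (1 : ℝ)) y y' * G w c m2 y' x'))
        + ∑ μ : Fin P.d, (S1ins w c m2 μ2 e Q μ x x' + S2ins w c m2 μ2 e Q μ x x' + S3ins w c m2 μ2 e Q μ x x') := by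
  rw [Ins7, S0ins]
  congr 1
  exact Finset.sum_congr rfl fun y _ => Finset.sum_congr rfl fun y' _ => by
    rw [ins7_eq_sig7 w c m2 μ2 e Q D he hq hC0 hC hwD hcD]

/-- **THE ORDER `e²δm²` OF THE TWO-POINT FUNCTION (1.19)/(1.20), DERIVED.** Hypotheses and letters as in BRICK 7
(`B3Eq122ChargeWick.secondOrder_structure121_op`: `η^d > 0`, `m² > 0`, `μ₀² > 0`, `cη = 1`, Feynman gauge, p26's data `D` of
(1.22) with `D.C0 = C₀ = C^η_{m²}`, `D.C = C^ε`), and `T(u,v) := (e²/2)∂²_e∣₀G_{ab}(u,v)` the derived order-e² kernel at mass `m²`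
(`= C₀[② + ④ + Σ_μ(∂^{ε*}_μΣ₁,μ + Σ₁,μ^*∂^ε_μ + ∂^{ε*}_μΣ₂∂^ε_μ)]C₀`, BRICK 7). THEN, as a function of the scalar mass `m₀² =
m² + δm²` of (1.20) (`J_mass_shift_eq_exp_neg_feynmanHiggsAction`), `T` is differentiable at `m₀² = m²` with
`∂_{m₀²}T(x,x′) = −Σ_zη^dC₀(x,z)T(z,x′) + Ins7(x,x′) − Σ_zη^dT(x,z)C₀(z,x′)`,
`Ins7 = C₀·(sig7 D 1)·C₀ + Σ_μ(C₀∂^{ε*}_μΣ⁽⁷⁾₁,μC₀ + C₀Σ⁽⁷⁾₁,μ^*∂^ε_μC₀ + C₀∂^{ε*}_μΣ⁽⁷⁾₂∂^ε_μC₀)` (`Ins7_eq_sig7`): multiplied by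
`δm²`, the first and last terms are the two `n = 2` cross terms `C₀(−δm²)C₀·X₂·C₀ + C₀·X₂·C₀(−δm²)C₀` of (1.21) (`X₂` = the
order-e² insertion), the middle one is the `n = 1` term with the order-`e²δm²` insertion, whose `Σ^ε`-part is EXACTLY THE
PRINTED ⑦ `e²Σ_μΣ_{x″}ε^dq(∂^ε_μC^ε_0)(x−x″)δm²(C^ε_0∂^{ε*}_μ)(x″−x′)qC^ε(x−x′)` (p26's `sig7 D δm²`) and whose `Σ₁^ε`/`Σ₂^ε`-parts
are the mass vertex on the internal scalar lines of BRICK 7's derived `Σ₁,μ`, `Σ₂` (`sgOneIns`, `sgTwoIns`; the paper displays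
neither). The mixed third derivative is taken in the order `∂²_e` at `e = 0`, then `∂_{m₀²}` at `m²`; no claim at other orders.
[cite: Balaban1983Higgs3, (1.19)–(1.22) p.416] -/
theorem hasDerivAt_secondOrder_mass (hw : 0 < w) (hm : 0 < m2) (hμ : 0 < μ2) (hcη : c * η = 1) (e : ℝ) (a b : Fin N)
    (D : SEData P j) (he : D.e = e) (hq : D.q2 = ⟪𝐞 a, C.q (C.q (𝐞 b))⟫_ℝ) (hC : D.C = G w c μ2) (hwD : D.w = w)
    (hcD : D.c = c) (x x' : Site P j) :
    HasDerivAt (fun M : ℝ => e ^ 2 / 2 * iteratedDeriv 2 (fun s => twoPt C η w c M μ2 s a b x x') 0)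
      ((-∑ z : Site P j, w * (G w c m2 x z * (e ^ 2 / 2 * iteratedDeriv 2 (fun s => twoPt C η w c m2 μ2 s a b z x') 0)))
        + Ins7 w c m2 μ2 e ⟪𝐞 a, C.q (C.q (𝐞 b))⟫_ℝ x x'
        + -∑ z : Site P j, w * ((e ^ 2 / 2 * iteratedDeriv 2 (fun s => twoPt C η w c m2 μ2 s a b x z) 0) * G w c m2 z x'))
      m2 := by
  have hE : ∀ {M : ℝ}, 0 < M → ∀ u v : Site P j, e ^ 2 / 2 * iteratedDeriv 2 (fun s => twoPt C η w c M μ2 s a b u v) 0 =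
      E2 η w c μ2 e ⟪𝐞 a, C.q (C.q (𝐞 b))⟫_ℝ M u v :=
    fun hM u v => secondOrder_eq_E2 C η w c μ2 hw hμ hcη e a b D he hq hC hwD hcD hM u v
  have h := hasDerivAt_E2 η w c m2 μ2 hw hm e ⟪𝐞 a, C.q (C.q (𝐞 b))⟫_ℝ x x'
  have hev : (fun M : ℝ => e ^ 2 / 2 * iteratedDeriv 2 (fun s => twoPt C η w c M μ2 s a b x x') 0) =ᶠ[𝓝 m2]
      fun M : ℝ => E2 η w c μ2 e ⟪𝐞 a, C.q (C.q (𝐞 b))⟫_ℝ M x x' := by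
    filter_upwards [Ioi_mem_nhds hm] with M hM
    exact hE hM x x'
  refine (h.congr_of_eventuallyEq hev).congr_deriv ?_
  simp only [hE hm]

omit C η w c m2 μ2 in
/-- shifting the base point: `∂_t∣₀f(a+t) = f′(a)`. [folklore] -/
private theorem hasDerivAt_comp_const_add_zero {f : ℝ → ℝ} {f' a : ℝ} (hf : HasDerivAt f f' a) :
    HasDerivAt (fun t : ℝ => f (a + t)) f' 0 := by
  have h : HasDerivAt f f' (a + 0) := by rwa [add_zero]
  exact h.comp_const_add a 0

/-- **THE SAME IN THE COUNTERTERM VARIABLE**: `δm² ↦ (e²/2)∂²_e∣₀G_{ab}(x,x′; m²+δm²)` (the two-point function of the action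
(1.20) with counterterm `δm²`, `λ = 0`) has at `δm² = 0` the derivative of `hasDerivAt_secondOrder_mass` — the coefficient of
`e²δm²` in (1.19) (Taylor in `e` at `0` to second order, then in `δm²` to first order). [cite: Balaban1983Higgs3, (1.19)–(1.22) p.416] -/
theorem hasDerivAt_counterterm_secondOrder (hw : 0 < w) (hm : 0 < m2) (hμ : 0 < μ2) (hcη : c * η = 1) (e : ℝ)
    (a b : Fin N) (D : SEData P j) (he : D.e = e) (hq : D.q2 = ⟪𝐞 a, C.q (C.q (𝐞 b))⟫_ℝ) (hC : D.C = G w c μ2)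
    (hwD : D.w = w) (hcD : D.c = c) (x x' : Site P j) :
    HasDerivAt (fun dm2 : ℝ => e ^ 2 / 2 * iteratedDeriv 2 (fun s => twoPt C η w c (m2 + dm2) μ2 s a b x x') 0)
      ((-∑ z : Site P j, w * (G w c m2 x z * (e ^ 2 / 2 * iteratedDeriv 2 (fun s => twoPt C η w c m2 μ2 s a b z x') 0)))
        + Ins7 w c m2 μ2 e ⟪𝐞 a, C.q (C.q (𝐞 b))⟫_ℝ x x'
        + -∑ z : Site P j, w * ((e ^ 2 / 2 * iteratedDeriv 2 (fun s => twoPt C η w c m2 μ2 s a b x z) 0) * G w c m2 z x'))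
      0 := by
  exact hasDerivAt_comp_const_add_zero
    (hasDerivAt_secondOrder_mass C η w c m2 μ2 hw hm hμ hcη e a b D he hq hC hwD hcD x x')

/-- the order `e¹δm²ᵏ` vanishes for every `k`: `∂_e∣₀G_{ab}(x,x′; m²+δm²) = 0` at every `δm² > −m²` (one vector leg against the
even Gaussian, BRICK 7 `twoPt_zero`). [cite: Balaban1983Higgs3, (1.19), (1.21) p.416] -/
theorem deriv_twoPt_zero_mass (hw : 0 < w) (hμ : 0 < μ2) {dm2 : ℝ} (hdm : 0 < m2 + dm2) (a b : Fin N)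
    (x x' : Site P j) : deriv (fun e => twoPt C η w c (m2 + dm2) μ2 e a b x x') 0 = 0 :=
  (twoPt_zero C η w c (m2 + dm2) μ2 hw hdm hμ a b x x').2

end MainTheorem

/-! ## §6 (1.21) AT ORDER `e²δm²` AS OPERATORS: `C₀(−δm²)C₀·X₂·C₀ + C₀·X₂·C₀(−δm²)C₀ + C₀·X⁽⁷⁾·C₀` -/

section OperatorForm

variable (μ2 : ℝ)

/-- the standard orthonormal basis vector `e_a` of `R^N` (notation local to this file). [folklore] -/
local notation "𝐞" => EuclideanSpace.basisFun (Fin N) ℝ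

omit C η c m2 μ2 in
/-- linearity of r15's integral operator `kernelOp` in the function. [cite: Balaban1983Higgs3, (3.9) p.435] -/
private theorem kernelOp_add_right' (K : Kernel P j) (f g : SiteField P j ℝ) :
    kernelOp w K (f + g) = kernelOp w K f + kernelOp w K g := by
  funext x
  simp only [kernelOp, Pi.add_apply, mul_add, Finset.sum_add_distrib]

omit C η c m2 μ2 in
/-- `kernelOp` of a finite sum of functions. [cite: Balaban1983Higgs3, (3.9) p.435] -/
private theorem kernelOp_sum_right' (K : Kernel P j) (g : Fin P.d → SiteField P j ℝ) :
    kernelOp w K (∑ μ : Fin P.d, g μ) = ∑ μ : Fin P.d, kernelOp w K (g μ) := by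
  funext x
  simp only [kernelOp, Finset.sum_apply, Finset.mul_sum]
  rw [Finset.sum_comm]

omit C η c m2 μ2 in
/-- `kernelOp` is homogeneous in the function. [cite: Balaban1983Higgs3, (3.9) p.435] -/
theorem kernelOp_smul_right (K : Kernel P j) (r : ℝ) (f : SiteField P j ℝ) :
    kernelOp w K (r • f) = r • kernelOp w K f := by
  funext x
  simp only [kernelOp, Pi.smul_apply, smul_eq_mul, Finset.mul_sum]
  exact Finset.sum_congr rfl fun x' _ => by ring

omit C η c m2 μ2 in
/-- a scalar multiple of a kernel acts as the scalar multiple of the operator. [cite: Balaban1983Higgs3, (3.9) p.435] -/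
theorem kernelOp_const_mul_kernel (K : Kernel P j) (r : ℝ) (f : SiteField P j ℝ) :
    kernelOp w (fun x x' => r * K x x') f = r • kernelOp w K f := by
  funext x
  simp only [kernelOp, Pi.smul_apply, smul_eq_mul, Finset.mul_sum]
  exact Finset.sum_congr rfl fun x' _ => by ring

omit C η c m2 μ2 in
/-- the kernel of a triple composition `A∘B∘K` with the volume element. [cite: Balaban1983Higgs3, (3.9) p.435] -/
private theorem kernelOp_comp₃' (A B K : Kernel P j) (f : SiteField P j ℝ) (x : Site P j) :
    kernelOp w A (kernelOp w B (kernelOp w K f)) x =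
      ∑ x' : Site P j, w * (∑ y : Site P j, ∑ y' : Site P j, w * w * (A x y * B y y' * K y' x')) * f x' := by
  calc kernelOp w A (kernelOp w B (kernelOp w K f)) x
      = ∑ y : Site P j, ∑ y' : Site P j, ∑ x' : Site P j, w * A x y * (w * B y y' * (w * K y' x' * f x')) := by
        simp only [kernelOp, Finset.mul_sum]
    _ = ∑ y : Site P j, ∑ x' : Site P j, ∑ y' : Site P j, w * A x y * (w * B y y' * (w * K y' x' * f x')) :=
        Finset.sum_congr rfl fun _ _ => Finset.sum_comm
    _ = ∑ x' : Site P j, ∑ y : Site P j, ∑ y' : Site P j, w * A x y * (w * B y y' * (w * K y' x' * f x')) := Finset.sum_comm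
    _ = _ := by
        refine Finset.sum_congr rfl fun x' _ => ?_
        rw [Finset.mul_sum, Finset.sum_mul]
        refine Finset.sum_congr rfl fun y _ => ?_
        rw [Finset.mul_sum, Finset.sum_mul]
        exact Finset.sum_congr rfl fun y' _ => by ring

omit C η c m2 μ2 in
/-- **a free propagator PREPENDED**: the kernel `−Σ_zη^dK(x,z)T(z,x′)` acts as `−K∘T`. [cite: Balaban1983Higgs3, (1.21) p.416] -/
theorem kernelOp_neg_chain_left (K T : Kernel P j) (f : SiteField P j ℝ) :
    kernelOp w (fun x x' => -∑ z : Site P j, w * (K x z * T z x')) f = -kernelOp w K (kernelOp w T f) := by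
  funext x
  simp only [kernelOp, Pi.neg_apply, Finset.mul_sum, Finset.sum_mul, neg_mul, mul_neg, Finset.sum_neg_distrib]
  rw [Finset.sum_comm]
  simp only [← Finset.sum_neg_distrib]
  exact Finset.sum_congr rfl fun z _ => Finset.sum_congr rfl fun x' _ => by ring

omit C η c m2 μ2 in
/-- **a free propagator APPENDED**: the kernel `−Σ_zη^dT(x,z)K(z,x′)` acts as `−T∘K`. [cite: Balaban1983Higgs3, (1.21) p.416] -/
theorem kernelOp_neg_chain_right (T K : Kernel P j) (f : SiteField P j ℝ) :
    kernelOp w (fun x x' => -∑ z : Site P j, w * (T x z * K z x')) f = -kernelOp w T (kernelOp w K f) := by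
  funext x
  simp only [kernelOp, Pi.neg_apply, Finset.mul_sum, Finset.sum_mul, neg_mul, mul_neg, Finset.sum_neg_distrib]
  rw [Finset.sum_comm]
  simp only [← Finset.sum_neg_distrib]
  exact Finset.sum_congr rfl fun z _ => Finset.sum_congr rfl fun x' _ => by ring

omit C η c m2 μ2 in
/-- a sum of three kernels acts as the sum of the operators. [cite: Balaban1983Higgs3, (3.9) p.435] -/
theorem kernelOp_add₃_kernel (A B K : Kernel P j) (f : SiteField P j ℝ) :
    kernelOp w (fun x x' => A x x' + B x x' + K x x') f = kernelOp w A f + kernelOp w B f + kernelOp w K f := by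
  funext x
  simp only [kernelOp, Pi.add_apply, mul_add, add_mul, Finset.sum_add_distrib]

omit C η in
/-- **THE `n = 1` TERM AT ORDER `e²δm²` AS OPERATORS**: the kernel `Ins7` acts as
`C₀[⑦₁ + Σ_μ(∂^{η*}_μΣ⁽⁷⁾₁,μ + Σ⁽⁷⁾₁,μ^*∂^η_μ + ∂^{η*}_μΣ⁽⁷⁾₂∂^η_μ)]C₀` (`⑦₁ = ins7 = sig7 D 1`, `Σ⁽⁷⁾₁,μ^*` the transposed kernel),
in r15's `kernelOp`/`pdiff`/`pdiffAdj` vocabulary — the shape of the bracket of (1.21). [cite: Balaban1983Higgs3, (1.21) p.416] -/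
theorem kernelOp_Ins7 (e Q : ℝ) (f : SiteField P j ℝ) :
    kernelOp w (Ins7 w c m2 μ2 e Q) f =
      kernelOp w (G w c m2)
        (kernelOp w (ins7 w c m2 μ2 e Q) (kernelOp w (G w c m2) f)
          + ∑ μ : Fin P.d,
            (pdiffAdj c μ (kernelOp w (sgOneIns w c m2 μ2 e Q μ) (kernelOp w (G w c m2) f))
              + kernelOp w (fun y y' => sgOneIns w c m2 μ2 e Q μ y' y) (pdiff c μ (kernelOp w (G w c m2) f))
              + pdiffAdj c μ (kernelOp w (sgTwoIns w c m2 μ2 e Q) (pdiff c μ (kernelOp w (G w c m2) f))))) := by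
  funext x
  have hR0 : kernelOp w (G w c m2) (kernelOp w (ins7 w c m2 μ2 e Q) (kernelOp w (G w c m2) f)) x =
      ∑ x' : Site P j, w * S0ins w c m2 μ2 e Q x x' * f x' := by
    rw [kernelOp_comp₃']
    rfl
  have hR1 : ∀ μ : Fin P.d, kernelOp w (G w c m2) (pdiffAdj c μ (kernelOp w (sgOneIns w c m2 μ2 e Q μ)
      (kernelOp w (G w c m2) f))) x = ∑ x' : Site P j, w * S1ins w c m2 μ2 e Q μ x x' * f x' := by
    intro μ
    show _ = ∑ x' : Site P j, w * (∑ y : Site P j, ∑ y' : Site P j, w * w *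
      (d1Kernel c μ (G w c m2) y x * sgOneIns w c m2 μ2 e Q μ y y' * G w c m2 y' x')) * f x'
    rw [← kernelOp_comp₃' w (fun u v => d1Kernel c μ (G w c m2) v u)]
    exact sum_G_mul_pdiffAdj w c m2 μ _ x
  have hR2 : ∀ μ : Fin P.d, kernelOp w (G w c m2) (kernelOp w (fun y y' => sgOneIns w c m2 μ2 e Q μ y' y)
      (pdiff c μ (kernelOp w (G w c m2) f))) x = ∑ x' : Site P j, w * S2ins w c m2 μ2 e Q μ x x' * f x' := by
    intro μ
    rw [← kernelOp_d1Kernel, kernelOp_comp₃']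
    rfl
  have hR3 : ∀ μ : Fin P.d, kernelOp w (G w c m2) (pdiffAdj c μ (kernelOp w (sgTwoIns w c m2 μ2 e Q)
      (pdiff c μ (kernelOp w (G w c m2) f)))) x = ∑ x' : Site P j, w * S3ins w c m2 μ2 e Q μ x x' * f x' := by
    intro μ
    show _ = ∑ x' : Site P j, w * (∑ y : Site P j, ∑ y' : Site P j, w * w *
      (d1Kernel c μ (G w c m2) y x * sgTwoIns w c m2 μ2 e Q y y' * d1Kernel c μ (G w c m2) y' x')) * f x'
    rw [← kernelOp_d1Kernel, ← kernelOp_comp₃' w (fun u v => d1Kernel c μ (G w c m2) v u)]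
    exact sum_G_mul_pdiffAdj w c m2 μ _ x
  rw [kernelOp_add_right', kernelOp_sum_right']
  simp only [Pi.add_apply, Finset.sum_apply, kernelOp_add_right', hR0, hR1, hR2, hR3]
  simp only [kernelOp, Ins7, mul_add, add_mul, Finset.sum_add_distrib, Finset.mul_sum, Finset.sum_mul]
  congr 1
  congr 1
  congr 1
  all_goals exact Finset.sum_comm

/-- **(1.21) AT ORDER `e²δm²`, AS OPERATORS, DERIVED FROM (1.19)/(1.20).** Let `𝒯 g := kernelOp η^d T g` be the integral
operator of the derived order-e² kernel `T = (e²/2)∂²_e∣₀G_{ab}` at mass `m²` — by BRICK 7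
(`B3Eq122ChargeWick.secondOrder_structure121_op`) `𝒯 = C₀[Σ + Σ_μ(∂^{η*}_μΣ₁,μ + Σ₁,μ^*∂^η_μ + ∂^{η*}_μΣ₂∂^η_μ)]C₀ =: C₀X₂C₀`.
Then for every `δm²` and every test function `f`, the integral operator of `δm²·∂_{m₀²}∣_{m²}T` (the order-`e²δm²` Taylor term
of (1.19) in the sense of `hasDerivAt_counterterm_secondOrder`) is
`C₀(−δm²·𝒯f) + 𝒯(−δm²·C₀f) + C₀[δm²·(⑦₁ + Σ_μ(∂^{η*}_μΣ⁽⁷⁾₁,μ + Σ⁽⁷⁾₁,μ^*∂^η_μ + ∂^{η*}_μΣ⁽⁷⁾₂∂^η_μ))](C₀f)`, i.e.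
`C₀(−δm²)C₀X₂C₀ + C₀X₂C₀(−δm²)C₀` (the two `n = 2` cross terms of (1.21)) `+ C₀X⁽⁷⁾C₀` (the `n = 1` term, `X⁽⁷⁾ ∋ ⑦ = sig7 D δm²`).
[cite: Balaban1983Higgs3, (1.21)–(1.22) p.416] -/
theorem secondOrderMass_structure121_op (e : ℝ) (a b : Fin N) (dm2 : ℝ) (f : SiteField P j ℝ) :
    kernelOp w (fun x x' => dm2 *
        ((-∑ z : Site P j, w * (G w c m2 x z * (e ^ 2 / 2 * iteratedDeriv 2 (fun s => twoPt C η w c m2 μ2 s a b z x') 0)))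
          + Ins7 w c m2 μ2 e ⟪𝐞 a, C.q (C.q (𝐞 b))⟫_ℝ x x'
          + -∑ z : Site P j, w *
              ((e ^ 2 / 2 * iteratedDeriv 2 (fun s => twoPt C η w c m2 μ2 s a b x z) 0) * G w c m2 z x'))) f =
      kernelOp w (G w c m2) ((-dm2) •
          kernelOp w (fun u v => e ^ 2 / 2 * iteratedDeriv 2 (fun s => twoPt C η w c m2 μ2 s a b u v) 0) f)
        + kernelOp w (G w c m2) (dm2 •
            (kernelOp w (ins7 w c m2 μ2 e ⟪𝐞 a, C.q (C.q (𝐞 b))⟫_ℝ) (kernelOp w (G w c m2) f)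
              + ∑ μ : Fin P.d,
                (pdiffAdj c μ (kernelOp w (sgOneIns w c m2 μ2 e ⟪𝐞 a, C.q (C.q (𝐞 b))⟫_ℝ μ) (kernelOp w (G w c m2) f))
                  + kernelOp w (fun y y' => sgOneIns w c m2 μ2 e ⟪𝐞 a, C.q (C.q (𝐞 b))⟫_ℝ μ y' y)
                      (pdiff c μ (kernelOp w (G w c m2) f))
                  + pdiffAdj c μ (kernelOp w (sgTwoIns w c m2 μ2 e ⟪𝐞 a, C.q (C.q (𝐞 b))⟫_ℝ)
                      (pdiff c μ (kernelOp w (G w c m2) f))))))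
        + kernelOp w (fun u v => e ^ 2 / 2 * iteratedDeriv 2 (fun s => twoPt C η w c m2 μ2 s a b u v) 0)
            ((-dm2) • kernelOp w (G w c m2) f) := by
  rw [kernelOp_const_mul_kernel, kernelOp_add₃_kernel, kernelOp_neg_chain_left, kernelOp_neg_chain_right, kernelOp_Ins7,
    kernelOp_smul_right, kernelOp_smul_right, kernelOp_smul_right, smul_add, smul_add, neg_smul, neg_smul, smul_neg,
    smul_neg]

end OperatorForm


/-! ## §7 (v1.1) THE PRINTED SERIES (1.21) IN THE PURE-COUNTERTERM SECTOR CONVERGES TO THE TWO-POINT FUNCTION -/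

section NeumannSeries

/-! The matrix ring `Matrix T T ℝ` normed as operators on `ℓ^∞(T)` (Mathlib's `Matrix.linftyOp*` structures, local instances as
Mathlib prescribes; the induced topology is the product topology). -/
attribute [local instance] Matrix.linftyOpNormedAddCommGroup Matrix.linftyOpNormedSpace Matrix.linftyOpNormedRing
  Matrix.linftyOpNormedAlgebra

omit C η m2 in
/-- the size of the insertion `(−δm²)·(η^dC_{m²})` in the operator norm: `‖(−δm²·1)(η^dC_{m²})‖ = ∣δm²∣·‖η^dC_{m²}‖`.
[cite: Balaban1983Higgs3, (1.21) p.416] -/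
theorem norm_counterterm_insertion (m2 dm2 : ℝ) :
    ‖(-(dm2 • (1 : Matrix (Site P j) (Site P j) ℝ))) * (w • G w c m2)‖ =
      |dm2| * ‖(w • G w c m2 : Matrix (Site P j) (Site P j) ℝ)‖ := by
  rw [neg_mul, norm_neg, Matrix.smul_mul, Matrix.one_mul, norm_smul, Real.norm_eq_abs]

omit C η m2 in
/-- **(1.21) LITERALLY, IN THE SECTOR `e = λ = 0`**: for `∣δm²∣·‖η^dC^η_{m²}‖ < 1` (operator norm on `ℓ^∞(T)`; `m² > 0`,
`m² + δm² > 0`) the printed series `Σ_{n=0}^∞C₀[(−δm²)C₀]ⁿ` CONVERGES and its sum IS `η^d·C^η_{m²+δm²}` — by §3 the two-point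
function (1.19) of the action (1.20) at `e = λ = 0` (`twoPt_zero_mass`): r15's `dysonTerm`, p32's normed-ring summation
`B3Eq121DysonSeries.eq_tsum_of_eq121` (uniqueness of the solution of `Eq121`) applied to `eq121_counterterm`.
[cite: Balaban1983Higgs3, (1.19), (1.21) p.416] -/
theorem smul_G_mass_shift_eq_tsum_dysonTerm (hw : 0 < w) {m2 dm2 : ℝ} (hm : 0 < m2) (hdm : 0 < m2 + dm2)
    (hsmall : |dm2| * ‖(w • G w c m2 : Matrix (Site P j) (Site P j) ℝ)‖ < 1) :
    w • G w c (m2 + dm2) =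
      ∑' n : ℕ, B3Sect1TwoPoint.dysonTerm (w • G w c m2) (-(dm2 • (1 : Matrix (Site P j) (Site P j) ℝ))) n :=
  B3Eq121DysonSeries.eq_tsum_of_eq121 (by rwa [norm_counterterm_insertion]) (eq121_counterterm w c hw hm hdm)

omit C η m2 in
/-- entrywise: `C^η_{m²+δm²}(x,y) = η^{−d}·(Σ'_n (η^dC₀)[(−δm²)(η^dC₀)]ⁿ)(x,y)` — the two-point function `G_{0,ab}(x,y; m²+δm²) =
C^η_{m²+δm²}(y,x)δ_{ab}` of §3 is the sum of the printed series. [cite: Balaban1983Higgs3, (1.19), (1.21) p.416] -/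
theorem G_mass_shift_eq_tsum_dysonTerm_apply (hw : 0 < w) {m2 dm2 : ℝ} (hm : 0 < m2) (hdm : 0 < m2 + dm2)
    (hsmall : |dm2| * ‖(w • G w c m2 : Matrix (Site P j) (Site P j) ℝ)‖ < 1) (x y : Site P j) :
    G w c (m2 + dm2) x y = w⁻¹ *
      (∑' n : ℕ, B3Sect1TwoPoint.dysonTerm (w • G w c m2) (-(dm2 • (1 : Matrix (Site P j) (Site P j) ℝ))) n) x y := by
  have h := congrFun (congrFun (smul_G_mass_shift_eq_tsum_dysonTerm w c hw hm hdm hsmall) x) y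
  rw [Matrix.smul_apply, smul_eq_mul] at h
  rw [← h, ← mul_assoc, inv_mul_cancel₀ hw.ne', one_mul]

end NeumannSeries

end Literature.MathematicalPhysics.QuantumFieldTheory.Balaban1983to89.B3Eq122MassInsertionWick

end
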